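import Mathlib.Analysis.InnerProductSpace.Calculus
import Mathlib.Analysis.Normed.Module.Normalize
import Mathlib.Analysis.SpecialFunctions.Sqrt
import Mathlib.Analysis.Convex.Contractible
import Mathlib.AlgebraicTopology.FundamentalGroupoid.SimplyConnected
import Literature.Topology.FourManifolds.DehnSurgery
import Literature.Topology.FourManifolds.DehnSurgeryTubularNbhdProofs
import Literature.Topology.FourManifolds.GluckTwistUnknotProofs
import Literature.Topology.FourManifolds.KirbyMoves
import Literature.Topology.FourManifolds.SmoothEmbeddingCriteria
import HarnessLib

/-!
# `0`-surgery on the unknot is `S² × S¹`: discharge of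
`Literature.Topology.FourManifolds.isIntegralSurgery_unknot_zero`

Sibling proof file of `DehnSurgery.lean` (D-0014: the named fact
`def isIntegralSurgery_unknot_zero : Prop` is discharged here as
`theorem isIntegralSurgery_unknot_zero_holds : isIntegralSurgery_unknot_zero`, sorry-free). The fact
says that the product manifold `↥(𝕊 2) × ↥(𝕊 1)` (model `(𝓡 2).prod (𝓡 1)`) *is a* `0`-surgery on
the unknot in the relational sense of `Literature.Topology.FourManifolds.IsIntegralSurgery`: for some
oriented tubular neighbourhood `ν` of `unknot` of framing `0` there are open smooth embeddings
`jA : S³ ∖ U → S² × S¹`, `jB : D̊² × S¹ → S² × S¹`, jointly surjective, identifying exactly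
`ν (u, t • v)` with `(t • u, v)` for `u, v ∈ S¹`, `0 < t < 1`
(`Literature.Topology.FourManifolds.IsOpenGluing`, `Literature.Topology.FourManifolds.surgeryRel`). It is
the non-vacuity witness of Property R (`SurgeryGluck.lean`, `spc4.S25`) and the direction `←` of
`Literature.Topology.FourManifolds.isIntegralSurgery_sphereTwo_prod_zero_iff`.

## The printed argument

D. Rolfsen, *Knots and Links* (1976), §9.G Example 3 (the cite carried by the fact); R. C. Kirby,
*The Topology of 4-Manifolds*, LNM 1374 (1989), Ch. I §2: "Adding a 2-handle to an unknot with zero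
framing gives `S² × B²`, also with boundary `S¹ × S²`"; Gompf–Stipsicz, *4-Manifolds and Kirby
Calculus* (1999), §5.3. The exterior of the unknot `U ⊆ S³` is a solid torus whose meridian discs
are bounded by the `0`-framed longitudes (push-offs) of `U`; `0`-surgery glues a second solid torus
meridian-to-longitude, i.e. meridian-to-meridian of the exterior, and `D² × S¹ ∪_{id} D² × S¹ =
(D² ∪ D²) × S¹ = S² × S¹`.

## Its formalisation

Write `S³ ⊆ ℝ⁴ = ℝ² × ℝ²`, `p = (y, v)` (`hd p = y`, `tl p = v`, `app y v = p`); the unknot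
`unknot = sphereInclusion 1 3` is `{v = 0}` and its complement is `{v ≠ 0}`
(`mem_complement_unknot_iff`).

* *The oriented tubular neighbourhood.* `tube (x, w) = (x, w) / ‖(x, w)‖ : S¹ × ℝ² → S³` is a
  smooth embedding onto `{y ≠ 0}` with inverse `p ↦ (y / ‖y‖, v / ‖y‖)` (`tubeHomeomorph`, an
  `OpenPartialHomeomorph` with source `univ`, `C^∞` with `C^∞` inverse, hence a smooth embedding
  by `Literature.Topology.FourManifolds.isSmoothEmbedding_of_openPartialHomeomorph`), `tube (x, 0) = unknot x`,
  and it is **positively oriented** (`det_pos_tube`): with `r = √(1 + ‖w‖²)` the four rows of the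
  frame of `Knot.TubularNbhd.det_pos` are `r⁻¹ (x, w)`, `r⁻¹ (x^⊥, 0)`, `r⁻¹ e₂ - w₀ r⁻³ (x, w)`,
  `r⁻¹ e₃ - w₁ r⁻³ (x, w)` (`hasDerivAt_tube_circlePoint`, `hasDerivAt_tube_normal`), of
  determinant `r⁻⁴ (cos² + sin²) > 0` (cofactor expansion `frameDet_expand` of
  `DehnSurgeryTubularNbhdProofs.lean` and `ring`). This is `unknotTube : Knot.TubularNbhd unknot`.
* *Framing `0`.* The longitude `θ ↦ ν (e^{2πiθ}, e₀)` of the tube is the image of the circle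
  `θ ↦ (2 cos 2πθ, 2 sin 2πθ, 0)` of `ℝ³` under the continuous map
  `q ↦ (q₀, q₁, 1, q₂) / ‖(q₀, q₁, 1, q₂)‖ : ℝ³ → S³ ∖ U` (`capMap`; the radial projection is scale
  invariant, `capPoint_capCircle`); `ℝ³` is convex, hence simply connected, so the circle is
  null-homotopic and the class of the longitude in `π₁(S³ ∖ U)ᵃᵇ` is trivial
  (`hasFraming_unknotTube`, the argument of `BlowDownModelSphere.hasFraming_nbhd`).
* *The embeddings.* `jA (y, v) = (Φ (y, v), v / ‖v‖)` with `Φ (y, v) = (2 ‖v‖ y, ‖y‖² - ‖v‖²) ∈ S²`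
  (`glueA`, `phi`), a smooth embedding of `S³ ∖ U` onto `{q₂ < 1} × S¹ = (S² ∖ {N}) × S¹` with
  inverse `(q, v) ↦ ((q₀, q₁) / 2ρ, ρ v)`, `ρ = √((1 - q₂) / 2)` (`glueAHomeomorph`); and
  `jB (p, v) = (σ p, v)` with `σ p = (2p, 1 - ‖p‖²) / (1 + ‖p‖²)` the inverse stereographic
  projection from the south pole (`glueB`, `sigma`), a smooth embedding of the open solid torus onto
  `{q₂ > 0} × S¹` with inverse `(q, v) ↦ ((q₀, q₁) / (1 + q₂), v)` (`glueBHomeomorph`). The two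
  ranges cover `S² × S¹` (`range_glueA_union_range_glueB`).
* *The gluing relation.* `Φ (tube (u, s v)) = σ (s u)` and the angular part of `tl (tube (u, s v))`
  is `v` (`phi_tube`, `circleProj_tl_tube`), whence `jA (ν (u, t v)) = jB (t u, v)`; conversely
  `jA a = jB (p, v)` forces `y ≠ 0` (else `Φ a` is the south pole), so `a = tube (u, s v')`
  (`tube_tubeInv`), and then `σ (s u) = σ p`, `v' = v` give `p = s u`, `0 < s = ‖p‖ < 1`
  (`sigma_injective`): `glueA_eq_glueB_iff`.

## References

* D. Rolfsen, *Knots and Links*, Publish or Perish (1976), §9.F, §9.G Example 3.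
  [cite: RolfsenKnotsLinks1976, §9.G Example 3]
* R. C. Kirby, *The Topology of 4-Manifolds*, LNM 1374, Springer (1989), Ch. I §2 (p. 7 of the
  held copy: "Adding a 2-handle to an unknot with zero framing gives `S² × B²`, also with boundary
  `S¹ × S²`"). [cite: Kirby1989, Ch. I §2]
* R. E. Gompf, A. I. Stipsicz, *4-Manifolds and Kirby Calculus*, GSM 20 (1999), §5.3.
  [cite: GompfStipsiczGSM1999, §5.3]
* J. M. Lee, *Introduction to Smooth Manifolds*, 2nd ed. (2013), Prop. 5.2 (smooth embeddings with
  open image).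

## Design notes

* All auxiliary constructions live in the namespace `Literature.Topology.FourManifolds.SurgeryUnknot`;
  only the discharge `Literature.Topology.FourManifolds.isIntegralSurgery_unknot_zero_holds` is
  outside it. The coordinate conventions (`hd`, `tl`, `app`), the tube and the
  `OpenPartialHomeomorph` pattern follow `GluckTwistUnknotProofs.lean` (the analogous 4-dimensional
  statement `isGluckTwist_sphere_unknotTwo_holds`) one dimension down; its lemmas
  `GluckUnknot.contDiffOn_normalize` and `contMDiffOn_sphere_of_coe` are reused, as are
  `frameDet_expand`, `euclideanSpace_single_eq_smul` (`DehnSurgeryTubularNbhdProofs.lean`) and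
  `norm_sq_eq_of_fin_two` (`KirbyMoves.lean`).
* The `Fact (finrank ℝ ℝⁿ⁺¹ = n + 1)` instances needed by Mathlib's sphere API are registered as
  *local* instances in both spellings `Fin (n + 1)` / `Fin m`.
* The discharge holds for every instance of the `Prop`-valued class
  `[SphereEmbedding.SmoothnessFacts]` under which `unknot` is defined (one is
  `SphereEmbedding.smoothnessFacts`, `KnotsProofs.lean`).
* No declaration in this file uses `sorry`; `#print axioms isIntegralSurgery_unknot_zero_holds` lists
  only `propext`, `Classical.choice`, `Quot.sound`.
-/

open scoped Manifold ContDiff Topology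
open Function Set

noncomputable section

namespace Literature.Topology.FourManifolds

namespace SurgeryUnknot

/-- Local notation: `𝔼 n` is the model Euclidean space `EuclideanSpace ℝ (Fin n)`. -/
local notation "𝔼 " n:arg => EuclideanSpace ℝ (Fin n)

/-- Local notation: `𝕊 n` is the unit sphere in `EuclideanSpace ℝ (Fin (n + 1))`. -/
local notation "𝕊 " n:arg => (Metric.sphere (0 : EuclideanSpace ℝ (Fin (n + 1))) 1)

/-! ## Coordinates on `ℝ⁴ = ℝ² × ℝ²` -/

/-- The first two coordinates `(p₀, p₁) ∈ ℝ²` of `p ∈ ℝ⁴`. [folklore] -/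
def hd (p : 𝔼 4) : 𝔼 2 := WithLp.toLp 2 ![p 0, p 1]

/-- The last two coordinates `(p₂, p₃) ∈ ℝ²` of `p ∈ ℝ⁴`. [folklore] -/
def tl (p : 𝔼 4) : 𝔼 2 := WithLp.toLp 2 ![p 2, p 3]

/-- Concatenation `ℝ² × ℝ² → ℝ⁴`, `(y, v) ↦ (y₀, y₁, v₀, v₁)`. [folklore] -/
def app (y v : 𝔼 2) : 𝔼 4 := WithLp.toLp 2 ![y 0, y 1, v 0, v 1]

/-- Coordinate `0` of `hd`. [folklore] -/
@[simp] theorem hd_apply_zero (p : 𝔼 4) : hd p 0 = p 0 := rfl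

/-- Coordinate `1` of `hd`. [folklore] -/
@[simp] theorem hd_apply_one (p : 𝔼 4) : hd p 1 = p 1 := rfl

/-- Coordinate `0` of `tl`. [folklore] -/
@[simp] theorem tl_apply_zero (p : 𝔼 4) : tl p 0 = p 2 := rfl

/-- Coordinate `1` of `tl`. [folklore] -/
@[simp] theorem tl_apply_one (p : 𝔼 4) : tl p 1 = p 3 := rfl

/-- Coordinate `0` of `app`. [folklore] -/
@[simp] theorem app_apply_zero (y v : 𝔼 2) : app y v 0 = y 0 := rfl

/-- Coordinate `1` of `app`. [folklore] -/
@[simp] theorem app_apply_one (y v : 𝔼 2) : app y v 1 = y 1 := rfl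

/-- Coordinate `2` of `app`. [folklore] -/
@[simp] theorem app_apply_two (y v : 𝔼 2) : app y v 2 = v 0 := rfl

/-- Coordinate `3` of `app`. [folklore] -/
@[simp] theorem app_apply_three (y v : 𝔼 2) : app y v 3 = v 1 := rfl

/-- `hd (app y v) = y`. [folklore] -/
@[simp] theorem hd_app (y v : 𝔼 2) : hd (app y v) = y := by
  ext i; fin_cases i <;> rfl

/-- `tl (app y v) = v`. [folklore] -/
@[simp] theorem tl_app (y v : 𝔼 2) : tl (app y v) = v := by
  ext i; fin_cases i <;> rfl

/-- `ℝ⁴ = ℝ² × ℝ²`: a vector is the concatenation of its head and its tail. [folklore] -/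
@[simp] theorem app_hd_tl (p : 𝔼 4) : app (hd p) (tl p) = p := by
  ext i; fin_cases i <;> rfl

/-- `hd` is linear (scalars). [folklore] -/
theorem hd_smul (c : ℝ) (p : 𝔼 4) : hd (c • p) = c • hd p := by
  ext i; fin_cases i <;> simp [hd]

/-- `tl` is linear (scalars). [folklore] -/
theorem tl_smul (c : ℝ) (p : 𝔼 4) : tl (c • p) = c • tl p := by
  ext i; fin_cases i <;> simp [tl]

/-- `app` is linear (scalars). [folklore] -/
theorem smul_app (c : ℝ) (y v : 𝔼 2) : c • app y v = app (c • y) (c • v) := by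
  ext i; fin_cases i <;> simp [app]

/-- Pythagoras: `‖(y, v)‖² = ‖y‖² + ‖v‖²`. [folklore] -/
theorem norm_sq_app (y v : 𝔼 2) : ‖app y v‖ ^ 2 = ‖y‖ ^ 2 + ‖v‖ ^ 2 := by
  simp only [EuclideanSpace.real_norm_sq_eq, Fin.sum_univ_four, Fin.sum_univ_two, app_apply_zero,
    app_apply_one, app_apply_two, app_apply_three]
  ring

/-- Pythagoras: `‖p‖² = ‖hd p‖² + ‖tl p‖²`. [folklore] -/
theorem norm_sq_eq_hd_tl (p : 𝔼 4) : ‖p‖ ^ 2 = ‖hd p‖ ^ 2 + ‖tl p‖ ^ 2 := by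
  rw [← norm_sq_app, app_hd_tl]

/-- On the unit sphere, `‖hd p‖² + ‖tl p‖² = 1`. [folklore] -/
theorem norm_sq_hd_add_norm_sq_tl (p : 𝕊 3) : ‖hd (p : 𝔼 4)‖ ^ 2 + ‖tl (p : 𝔼 4)‖ ^ 2 = 1 := by
  rw [← norm_sq_eq_hd_tl, norm_eq_of_mem_sphere p, one_pow]

/-- `hd` is `C^∞` (linear). [folklore] -/
theorem contDiff_hd : ContDiff ℝ ∞ hd := by
  unfold hd
  apply PiLp.contDiff_toLp.comp
  rw [contDiff_pi]
  intro i
  fin_cases i <;> simp <;> fun_prop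

/-- `tl` is `C^∞` (linear). [folklore] -/
theorem contDiff_tl : ContDiff ℝ ∞ tl := by
  unfold tl
  apply PiLp.contDiff_toLp.comp
  rw [contDiff_pi]
  intro i
  fin_cases i <;> simp <;> fun_prop

/-- `app` is jointly `C^∞` (linear). [folklore] -/
theorem contDiff_app : ContDiff ℝ ∞ (fun q : 𝔼 2 × 𝔼 2 ↦ app q.1 q.2) := by
  unfold app
  apply PiLp.contDiff_toLp.comp
  rw [contDiff_pi]
  intro i
  fin_cases i <;> simp <;> fun_prop

/-- Padding with two zeros is the standard inclusion `ℝ² ↪ ℝ⁴` of `Knots.lean` (used by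
`sphereInclusion 1 3`, i.e. by `unknot`). [folklore] -/
theorem app_zero_eq_euclideanInclusion (y : 𝔼 2) : app y 0 = euclideanInclusion 2 4 y := by
  ext i
  fin_cases i <;> simp [euclideanInclusion_apply]

/-! ## Local `Fact` instances for the sphere API -/

/-- `finrank ℝ ℝ³ = 2 + 1` (spelling `Fin 3`), for Mathlib's sphere API on `𝕊 2`. [folklore] -/
private theorem fact_finrank_three : Fact (Module.finrank ℝ (𝔼 3) = 2 + 1) :=
  ⟨finrank_euclideanSpace_fin⟩

/-- `finrank ℝ ℝ⁴ = 3 + 1` (spelling `Fin 4`), for Mathlib's sphere API on `𝕊 3`. [folklore] -/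
private theorem fact_finrank_four : Fact (Module.finrank ℝ (𝔼 4) = 3 + 1) :=
  ⟨finrank_euclideanSpace_fin⟩

/-- `finrank ℝ ℝ² = 1 + 1` (spelling `Fin 2`), for Mathlib's sphere API on `𝕊 1`. [folklore] -/
private theorem fact_finrank_two : Fact (Module.finrank ℝ (𝔼 2) = 1 + 1) :=
  ⟨finrank_euclideanSpace_fin⟩

/-- `finrank ℝ ℝ³ = 2 + 1` (spelling `Fin (2 + 1)`). [folklore] -/
private theorem fact_finrank_two_add_one :
    Fact (Module.finrank ℝ (EuclideanSpace ℝ (Fin (2 + 1))) = 2 + 1) :=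
  ⟨finrank_euclideanSpace_fin⟩

/-- `finrank ℝ ℝ⁴ = 3 + 1` (spelling `Fin (3 + 1)`). [folklore] -/
private theorem fact_finrank_three_add_one :
    Fact (Module.finrank ℝ (EuclideanSpace ℝ (Fin (3 + 1))) = 3 + 1) :=
  ⟨finrank_euclideanSpace_fin⟩

/-- `finrank ℝ ℝ² = 1 + 1` (spelling `Fin (1 + 1)`). [folklore] -/
private theorem fact_finrank_one_add_one :
    Fact (Module.finrank ℝ (EuclideanSpace ℝ (Fin (1 + 1))) = 1 + 1) :=
  ⟨finrank_euclideanSpace_fin⟩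

attribute [local instance] fact_finrank_three fact_finrank_four fact_finrank_two
  fact_finrank_two_add_one fact_finrank_three_add_one fact_finrank_one_add_one

/-! ## The tube around the unknot -/

/-- `(x, w) ≠ 0` in `ℝ⁴` for `x ∈ S¹`. [folklore] -/
theorem app_ne_zero (x : 𝕊 1) (w : 𝔼 2) : app x w ≠ 0 := by
  intro h
  have h1 := norm_sq_app x w
  rw [h, norm_zero, norm_eq_of_mem_sphere x] at h1
  nlinarith [sq_nonneg ‖w‖]

/-- `‖(x, w)‖ > 0` for `x ∈ S¹`. [folklore] -/
theorem norm_app_pos (x : 𝕊 1) (w : 𝔼 2) : 0 < ‖app (x : 𝔼 2) w‖ :=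
  norm_pos_iff.2 (app_ne_zero x w)

/-- `‖(x, w)‖ = √(1 + ‖w‖²)` for `x ∈ S¹`. [folklore] -/
theorem norm_app_coe (x : 𝕊 1) (w : 𝔼 2) : ‖app (x : 𝔼 2) w‖ = Real.sqrt (1 + ‖w‖ ^ 2) := by
  rw [eq_comm, Real.sqrt_eq_iff_eq_sq (by positivity) (norm_nonneg _), norm_sq_app,
    norm_eq_of_mem_sphere x, one_pow]

/-- The tube map as a map to `ℝ⁴`: `(x, w) ↦ (x, w) / ‖(x, w)‖`. [folklore] -/
def tubeVec (q : (𝕊 1) × 𝔼 2) : 𝔼 4 := NormedSpace.normalize (app q.1 q.2)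

/-- The tube map takes unit values. [folklore] -/
theorem norm_tubeVec (q : (𝕊 1) × 𝔼 2) : ‖tubeVec q‖ = 1 :=
  NormedSpace.norm_normalize (app_ne_zero q.1 q.2)

/-- **The tube around the unknot**: `S¹ × ℝ² → S³`, `(x, w) ↦ (x, w) / ‖(x, w)‖`, a
trivialisation of the (open) normal bundle of the great circle `U = S³ ∩ (ℝ² × {0})` whose image
is `S³` minus the dual great circle `S³ ∩ ({0} × ℝ²)` (Rolfsen (1976), §9.G Example 3: the
exterior of the unknot is a solid torus). [folklore] -/
def tube (q : (𝕊 1) × 𝔼 2) : 𝕊 3 := ⟨tubeVec q, by simp [norm_tubeVec q]⟩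

/-- The tube map in coordinates. [folklore] -/
@[simp] theorem coe_tube (q : (𝕊 1) × 𝔼 2) : (tube q : 𝔼 4) = tubeVec q := rfl

/-- The tube map in coordinates, as a scalar multiple. [folklore] -/
theorem tubeVec_eq_smul (q : (𝕊 1) × 𝔼 2) :
    tubeVec q = ‖app (q.1 : 𝔼 2) q.2‖⁻¹ • app (q.1 : 𝔼 2) q.2 := rfl

/-- The `hd`-component of `tube (x, w)` is `x / ‖(x, w)‖`. [folklore] -/
theorem hd_tubeVec (q : (𝕊 1) × 𝔼 2) :
    hd (tubeVec q) = ‖app (q.1 : 𝔼 2) q.2‖⁻¹ • (q.1 : 𝔼 2) := by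
  rw [tubeVec, NormedSpace.normalize, hd_smul, hd_app]

/-- The `tl`-component of `tube (x, w)` is `w / ‖(x, w)‖`. [folklore] -/
theorem tl_tubeVec (q : (𝕊 1) × 𝔼 2) :
    tl (tubeVec q) = ‖app (q.1 : 𝔼 2) q.2‖⁻¹ • q.2 := by
  rw [tubeVec, NormedSpace.normalize, tl_smul, tl_app]

/-- The `hd`-component of a point of the tube does not vanish. [folklore] -/
theorem hd_tubeVec_ne_zero (q : (𝕊 1) × 𝔼 2) : hd (tubeVec q) ≠ 0 := by
  rw [hd_tubeVec]
  exact smul_ne_zero (inv_ne_zero (norm_app_pos q.1 q.2).ne') (ne_zero_of_mem_unit_sphere q.1)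

/-- `‖hd (tube (x, w))‖ = 1 / ‖(x, w)‖`. [folklore] -/
theorem norm_hd_tubeVec (q : (𝕊 1) × 𝔼 2) :
    ‖hd (tubeVec q)‖ = ‖app (q.1 : 𝔼 2) q.2‖⁻¹ := by
  rw [hd_tubeVec, norm_smul, norm_inv, norm_norm, norm_eq_of_mem_sphere q.1, mul_one]

/-- `‖tl (tube (x, w))‖ = ‖w‖ / ‖(x, w)‖`. [folklore] -/
theorem norm_tl_tubeVec (q : (𝕊 1) × 𝔼 2) :
    ‖tl (tubeVec q)‖ = ‖app (q.1 : 𝔼 2) q.2‖⁻¹ * ‖q.2‖ := by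
  rw [tl_tubeVec, norm_smul, norm_inv, norm_norm]

/-- The `tl`-component of `tube (x, w)` vanishes iff `w = 0`. [folklore] -/
theorem tl_tubeVec_ne_zero_iff (q : (𝕊 1) × 𝔼 2) : tl (tubeVec q) ≠ 0 ↔ q.2 ≠ 0 := by
  rw [tl_tubeVec, smul_ne_zero_iff]
  exact ⟨fun h ↦ h.2, fun h ↦ ⟨inv_ne_zero (norm_app_pos q.1 q.2).ne', h⟩⟩

/-- The radial projection `ℝ² → S¹`, `y ↦ y / ‖y‖`, with junk value `e₀` at `y = 0`. [folklore] -/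
def circleProj (y : 𝔼 2) : 𝕊 1 :=
  if h : y = 0 then ⟨EuclideanSpace.single 0 1, by simp⟩
  else ⟨NormedSpace.normalize y, by simp [NormedSpace.norm_normalize h]⟩

/-- The radial projection off the origin, in coordinates. [folklore] -/
theorem coe_circleProj {y : 𝔼 2} (hy : y ≠ 0) :
    (circleProj y : 𝔼 2) = NormedSpace.normalize y := by
  simp [circleProj, hy]

/-- The radial projection off the origin, as a scalar multiple. [folklore] -/
theorem coe_circleProj_eq_smul {y : 𝔼 2} (hy : y ≠ 0) :
    (circleProj y : 𝔼 2) = ‖y‖⁻¹ • y := by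
  rw [coe_circleProj hy]; rfl

/-- The radial projection of a positive multiple of `x ∈ S¹` is `x`. [folklore] -/
theorem circleProj_smul_coe {c : ℝ} (hc : 0 < c) (x : 𝕊 1) : circleProj (c • (x : 𝔼 2)) = x := by
  have h : c • (x : 𝔼 2) ≠ 0 := smul_ne_zero hc.ne' (ne_zero_of_mem_unit_sphere x)
  apply Subtype.ext
  rw [coe_circleProj h, NormedSpace.normalize_smul_of_pos hc,
    NormedSpace.normalize_eq_self_of_norm_eq_one (norm_eq_of_mem_sphere x)]

/-- A nonzero vector is its norm times its radial projection. [folklore] -/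
theorem norm_smul_coe_circleProj {y : 𝔼 2} (hy : y ≠ 0) : ‖y‖ • (circleProj y : 𝔼 2) = y := by
  rw [coe_circleProj_eq_smul hy, smul_smul, mul_inv_cancel₀ (norm_ne_zero_iff.2 hy), one_smul]

/-- The radial projection is `C^∞` off the origin (as a map into `S¹`). [folklore] -/
theorem contMDiffOn_circleProj : ContMDiffOn 𝓘(ℝ, 𝔼 2) (𝓡 1) ∞ circleProj {y | y ≠ 0} := by
  apply contMDiffOn_sphere_of_coe isOpen_ne
  exact (GluckUnknot.contDiffOn_normalize.contMDiffOn).congr fun y hy ↦ coe_circleProj hy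

/-- The inverse of the tube map, `(y, v) ↦ (y / ‖y‖, v / ‖y‖)` (junk value where `y = 0`).
[folklore] -/
def tubeInv (p : 𝕊 3) : (𝕊 1) × 𝔼 2 :=
  (circleProj (hd p), ‖hd (p : 𝔼 4)‖⁻¹ • tl p)

/-- `tubeInv` is a left inverse of `tube`. [folklore] -/
theorem tubeInv_tube (q : (𝕊 1) × 𝔼 2) : tubeInv (tube q) = q := by
  obtain ⟨x, w⟩ := q
  have hc : 0 < ‖app (x : 𝔼 2) w‖⁻¹ := inv_pos.2 (norm_app_pos x w)
  simp only [tubeInv, coe_tube]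
  rw [norm_hd_tubeVec, hd_tubeVec, tl_tubeVec, circleProj_smul_coe hc, smul_smul,
    inv_mul_cancel₀ hc.ne', one_smul]

/-- `tubeInv` is a right inverse of `tube` on `{y ≠ 0}`. [folklore] -/
theorem tube_tubeInv {p : 𝕊 3} (hp : hd (p : 𝔼 4) ≠ 0) : tube (tubeInv p) = p := by
  have hr : 0 < ‖hd (p : 𝔼 4)‖ := norm_pos_iff.2 hp
  apply Subtype.ext
  simp only [coe_tube, tubeVec, tubeInv, coe_circleProj hp]
  rw [show NormedSpace.normalize (hd (p : 𝔼 4)) = ‖hd (p : 𝔼 4)‖⁻¹ • hd p from rfl, ← smul_app,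
    app_hd_tl, NormedSpace.normalize_smul_of_pos (inv_pos.2 hr),
    NormedSpace.normalize_eq_self_of_norm_eq_one (norm_eq_of_mem_sphere p)]

/-- The tube map is `C^∞`. [folklore] -/
theorem contMDiff_tube : ContMDiff ((𝓡 1).prod 𝓘(ℝ, 𝔼 2)) (𝓡 3) ∞ tube := by
  have h1 : ContMDiff ((𝓡 1).prod 𝓘(ℝ, 𝔼 2)) 𝓘(ℝ, 𝔼 2) ∞ (fun q : (𝕊 1) × 𝔼 2 ↦ (q.1 : 𝔼 2)) :=
    contMDiff_coe_sphere.comp contMDiff_fst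
  have h2 : ContMDiff ((𝓡 1).prod 𝓘(ℝ, 𝔼 2)) 𝓘(ℝ, 𝔼 2) ∞ (fun q : (𝕊 1) × 𝔼 2 ↦ q.2) :=
    contMDiff_snd
  have h3 : ContMDiff ((𝓡 1).prod 𝓘(ℝ, 𝔼 2)) 𝓘(ℝ, 𝔼 4) ∞
      (fun q : (𝕊 1) × 𝔼 2 ↦ app (q.1 : 𝔼 2) q.2) :=
    contDiff_app.contMDiff.comp (h1.prodMk_space h2)
  have h4 : ContMDiff ((𝓡 1).prod 𝓘(ℝ, 𝔼 2)) 𝓘(ℝ, 𝔼 4) ∞ tubeVec :=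
    GluckUnknot.contDiffOn_normalize.contMDiffOn.comp_contMDiff h3 fun q ↦ app_ne_zero q.1 q.2
  exact h4.codRestrict_sphere fun q ↦ (tube q).2

/-- The set `{y ≠ 0} ⊆ S³` (the image of the tube) is open. [folklore] -/
theorem isOpen_hd_ne_zero : IsOpen {p : 𝕊 3 | hd (p : 𝔼 4) ≠ 0} :=
  isOpen_ne.preimage (contDiff_hd.continuous.comp continuous_subtype_val)

/-- The inverse of the tube map is `C^∞` on `{y ≠ 0}`. [folklore] -/
theorem contMDiffOn_tubeInv :
    ContMDiffOn (𝓡 3) ((𝓡 1).prod 𝓘(ℝ, 𝔼 2)) ∞ tubeInv {p : 𝕊 3 | hd (p : 𝔼 4) ≠ 0} := by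
  have hH : ContMDiff (𝓡 3) 𝓘(ℝ, 𝔼 2) ∞ (fun p : 𝕊 3 ↦ hd (p : 𝔼 4)) :=
    contDiff_hd.contMDiff.comp contMDiff_coe_sphere
  refine ContMDiffOn.prodMk ?_ ?_
  · exact contMDiffOn_circleProj.comp hH.contMDiffOn fun p hp ↦ hp
  · have hG : ContDiffOn ℝ ∞ (fun z : 𝔼 4 ↦ ‖hd z‖⁻¹ • tl z) {z | hd z ≠ 0} :=
      fun z hz ↦ (((contDiff_hd.contDiffAt.norm ℝ hz).inv (norm_ne_zero_iff.2 hz)).smul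
        contDiff_tl.contDiffAt).contDiffWithinAt
    exact hG.contMDiffOn.comp contMDiff_coe_sphere.contMDiffOn fun p hp ↦ hp

/-- The tube map as an open partial homeomorphism `S¹ × ℝ² ⇀ S³` with source `univ` and target
`{y ≠ 0}`. [folklore] -/
def tubeHomeomorph : OpenPartialHomeomorph ((𝕊 1) × 𝔼 2) (𝕊 3) where
  toFun := tube
  invFun := tubeInv
  source := univ
  target := {p : 𝕊 3 | hd (p : 𝔼 4) ≠ 0}
  map_source' q _ := hd_tubeVec_ne_zero q
  map_target' _ _ := mem_univ _
  left_inv' q _ := tubeInv_tube q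
  right_inv' _ hp := tube_tubeInv hp
  open_source := isOpen_univ
  open_target := isOpen_hd_ne_zero
  continuousOn_toFun := contMDiff_tube.continuous.continuousOn
  continuousOn_invFun := contMDiffOn_tubeInv.continuousOn

/-- **The tube map is a smooth embedding** `S¹ × ℝ² ↪ S³` (a globally defined partial
diffeomorphism between 3-manifolds, `Literature.Topology.FourManifolds.isSmoothEmbedding_of_openPartialHomeomorph`; Lee,
*Introduction to Smooth Manifolds*, Prop. 5.2). [folklore] -/
theorem isSmoothEmbedding_tube :
    Manifold.IsSmoothEmbedding ((𝓡 1).prod 𝓘(ℝ, 𝔼 2)) (𝓡 3) ∞ tube :=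
  isSmoothEmbedding_of_openPartialHomeomorph tubeHomeomorph rfl contMDiff_tube.contMDiffOn
    contMDiffOn_tubeInv (ContinuousLinearEquiv.ofFinrankEq (by simp))

/-- The tube map is injective. [folklore] -/
theorem tube_injective : Injective tube := isSmoothEmbedding_tube.isEmbedding.injective

/-- The image of the tube is `{y ≠ 0}`. [folklore] -/
theorem range_tube : range tube = {p : 𝕊 3 | hd (p : 𝔼 4) ≠ 0} := by
  rw [← image_univ]
  exact tubeHomeomorph.image_source_eq_target

/-! ## The tube is positively oriented (`Knot.TubularNbhd.det_pos`) -/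

/-- The radius `‖(x, w)‖ = √(1 + ‖w‖²)` of the point `(x, w)`, `x ∈ S¹`. [folklore] -/
def rad (w : 𝔼 2) : ℝ := Real.sqrt (1 + ‖w‖ ^ 2)

/-- The radius is positive. [folklore] -/
theorem rad_pos (w : 𝔼 2) : 0 < rad w := Real.sqrt_pos.2 (by positivity)

/-- The square of the radius. [folklore] -/
theorem rad_sq (w : 𝔼 2) : rad w ^ 2 = 1 + ‖w‖ ^ 2 := Real.sq_sqrt (by positivity)

/-- `‖(x, w)‖ = rad w` for `x ∈ S¹`. [folklore] -/
theorem norm_app_coe_eq_rad (x : 𝕊 1) (w : 𝔼 2) : ‖app (x : 𝔼 2) w‖ = rad w := norm_app_coe x w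

/-- The tube in coordinates: `tube (x, w) = (rad w)⁻¹ • (x, w)`. [folklore] -/
theorem coe_tube_eq (x : 𝕊 1) (w : 𝔼 2) :
    ((tube (x, w) : 𝕊 3) : 𝔼 4) = (rad w)⁻¹ • app (x : 𝔼 2) w := by
  rw [coe_tube, tubeVec_eq_smul, norm_app_coe_eq_rad]

/-- `app` is additive in the second variable along a line: `(x, w + s d) = (x, w) + s (0, d)`.
[folklore] -/
theorem app_add_smul (y w d : 𝔼 2) (s : ℝ) : app y (w + s • d) = app y w + s • app 0 d := by
  ext i; fin_cases i <;> simp [app]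

/-- The point `(circlePoint t, w)` of `ℝ⁴` decomposed along the coordinate axes. [folklore] -/
theorem app_circlePoint (t : ℝ) (w : 𝔼 2) : app (circlePoint t : 𝔼 2) w =
    Real.cos t • app (EuclideanSpace.single 0 1) 0 + Real.sin t • app (EuclideanSpace.single 1 1) 0
      + app 0 w := by
  ext i; fin_cases i <;> simp [app]

/-- **The `θ`-derivative of the tube**: `∂_t (rad w)⁻¹ (cos t, sin t, w) = (rad w)⁻¹ (-sin t, cos t, 0)`.
[folklore] -/
theorem hasDerivAt_tube_circlePoint (θ : ℝ) (w : 𝔼 2) :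
    HasDerivAt (fun t : ℝ ↦ ((tube (circlePoint t, w) : 𝕊 3) : 𝔼 4))
      ((rad w)⁻¹ • (-Real.sin θ • app (EuclideanSpace.single 0 1) 0
        + Real.cos θ • app (EuclideanSpace.single 1 1) 0)) θ := by
  have h1 : HasDerivAt (fun t : ℝ ↦ Real.cos t • app (EuclideanSpace.single 0 1) (0 : 𝔼 2)
      + Real.sin t • app (EuclideanSpace.single 1 1) (0 : 𝔼 2) + app 0 w)
      (-Real.sin θ • app (EuclideanSpace.single 0 1) 0
        + Real.cos θ • app (EuclideanSpace.single 1 1) 0) θ :=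
    (((Real.hasDerivAt_cos θ).smul_const _).add ((Real.hasDerivAt_sin θ).smul_const _)).add_const _
  have h2 := h1.const_smul (rad w)⁻¹
  refine h2.congr_of_eventuallyEq (Filter.Eventually.of_forall fun t ↦ ?_)
  show ((tube (circlePoint t, w) : 𝕊 3) : 𝔼 4) = (rad w)⁻¹ • _
  rw [coe_tube_eq, app_circlePoint]

/-- **The normal derivatives of the tube**: for `x ∈ S¹`,
`∂_s|₀ tube (x, w + s d) = (rad w)⁻¹ (0, d) - (⟪w, d⟫ / rad w³) (x, w)`. [folklore] -/
theorem hasDerivAt_tube_normal (x : 𝕊 1) (w d : 𝔼 2) :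
    HasDerivAt (fun s : ℝ ↦ ((tube (x, w + s • d) : 𝕊 3) : 𝔼 4))
      ((rad w)⁻¹ • app 0 d + (-(inner ℝ w d / rad w) / rad w ^ 2) • app (x : 𝔼 2) w) 0 := by
  -- the radius along the line `s ↦ w + s d`
  have hl : HasDerivAt (fun s : ℝ ↦ w + s • d) d 0 := by
    simpa using ((hasDerivAt_id (0 : ℝ)).smul_const d).const_add w
  have hf : HasDerivAt (fun s : ℝ ↦ 1 + ‖w + s • d‖ ^ 2) (2 * inner ℝ w d) 0 := by
    have h := hl.norm_sq
    simp only [zero_smul, add_zero] at h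
    exact h.const_add 1
  have hf0 : (1 : ℝ) + ‖w + (0 : ℝ) • d‖ ^ 2 = rad w ^ 2 := by rw [zero_smul, add_zero, rad_sq]
  have hsqrt : HasDerivAt (fun s : ℝ ↦ Real.sqrt (1 + ‖w + s • d‖ ^ 2)) (inner ℝ w d / rad w) 0 := by
    have h := hf.sqrt (by rw [hf0]; exact (pow_pos (rad_pos w) 2).ne')
    rw [hf0, Real.sqrt_sq (rad_pos w).le, mul_div_mul_left _ _ (two_ne_zero)] at h
    exact h
  have hinv : HasDerivAt (fun s : ℝ ↦ (Real.sqrt (1 + ‖w + s • d‖ ^ 2))⁻¹)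
      (-(inner ℝ w d / rad w) / rad w ^ 2) 0 := by
    have h := hsqrt.inv (by rw [hf0, Real.sqrt_sq (rad_pos w).le]; exact (rad_pos w).ne')
    rwa [hf0, Real.sqrt_sq (rad_pos w).le] at h
  have happ : HasDerivAt (fun s : ℝ ↦ app (x : 𝔼 2) w + s • app 0 d) (app 0 d) 0 := by
    simpa using ((hasDerivAt_id (0 : ℝ)).smul_const (app (0 : 𝔼 2) d)).const_add (app (x : 𝔼 2) w)
  have hprod := hinv.smul happ
  simp only [zero_smul, add_zero] at hprod
  refine hprod.congr_of_eventuallyEq (Filter.Eventually.of_forall fun s ↦ ?_)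
  show ((tube (x, w + s • d) : 𝕊 3) : 𝔼 4) =
    (Real.sqrt (1 + ‖w + s • d‖ ^ 2))⁻¹ • (app (x : 𝔼 2) w + s • app 0 d)
  rw [coe_tube_eq, app_add_smul]
  rfl

/-- `⟪w, eᵢ⟫ = wᵢ`. [folklore] -/
theorem inner_single_one_right (w : 𝔼 2) (i : Fin 2) :
    inner ℝ w (EuclideanSpace.single i (1 : ℝ)) = w i := by
  simp [EuclideanSpace.inner_single_right]

/-- The `θ`-derivative appearing in `det_pos`, computed. [folklore] -/
theorem deriv_tube_circlePoint (θ : ℝ) (w : 𝔼 2) :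
    deriv (fun t : ℝ ↦ ((tube (circlePoint t, w) : 𝕊 3) : 𝔼 4)) θ =
      (rad w)⁻¹ • (-Real.sin θ • app (EuclideanSpace.single 0 1) 0
        + Real.cos θ • app (EuclideanSpace.single 1 1) 0) :=
  (hasDerivAt_tube_circlePoint θ w).deriv

/-- The normal derivatives appearing in `det_pos`, computed. [folklore] -/
theorem deriv_tube_single (x : 𝕊 1) (w : 𝔼 2) (i : Fin 2) :
    deriv (fun s : ℝ ↦ ((tube (x, w + EuclideanSpace.single i s) : 𝕊 3) : 𝔼 4)) 0 =
      (rad w)⁻¹ • app 0 (EuclideanSpace.single i 1)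
        + (-(w i / rad w) / rad w ^ 2) • app (x : 𝔼 2) w := by
  have h := (hasDerivAt_tube_normal x w (EuclideanSpace.single i 1)).deriv
  rw [inner_single_one_right] at h
  rw [← h]
  congr 1
  funext s
  rw [euclideanSpace_single_eq_smul]

/-- **The tube is positively oriented**: the frame `(ν, ∂_θ ν, ∂_{w₀} ν, ∂_{w₁} ν)` of `ℝ⁴` has
determinant `(rad w)⁻⁴ > 0` (row-reduce the two normal derivatives by the position row: what is
left is `(rad w)⁻⁴ det (x, x^⊥, e₂, e₃) = (rad w)⁻⁴ (cos² + sin²)`). [folklore] -/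
theorem det_pos_tube (θ : ℝ) (w : 𝔼 2) : 0 < Matrix.det (Matrix.of
    ![⇑((tube (circlePoint θ, w) : 𝕊 3) : 𝔼 4),
      ⇑(deriv (fun t : ℝ ↦ ((tube (circlePoint t, w) : 𝕊 3) : 𝔼 4)) θ),
      ⇑(deriv (fun s : ℝ ↦ ((tube (circlePoint θ, w + EuclideanSpace.single 0 s) : 𝕊 3) : 𝔼 4)) 0),
      ⇑(deriv (fun s : ℝ ↦ ((tube (circlePoint θ, w + EuclideanSpace.single 1 s) : 𝕊 3) : 𝔼 4)) 0)]) := by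
  rw [← frameDet_eq, deriv_tube_circlePoint, deriv_tube_single, deriv_tube_single, coe_tube_eq,
    frameDet_expand]
  simp only [PiLp.add_apply, PiLp.smul_apply, smul_eq_mul, app_apply_zero,
    app_apply_one, app_apply_two, app_apply_three, PiLp.zero_apply, circlePoint_apply_zero,
    circlePoint_apply_one, PiLp.single_apply]
  simp only [Fin.isValue, ↓reduceIte, one_ne_zero, zero_ne_one, mul_zero, mul_one, add_zero,
    zero_add]
  have key : ∀ P : ℝ, P = (rad w)⁻¹ ^ 4 * (Real.cos θ ^ 2 + Real.sin θ ^ 2) → 0 < P := by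
    intro P hP
    rw [hP, Real.cos_sq_add_sin_sq, mul_one]
    exact pow_pos (inv_pos.2 (rad_pos w)) 4
  apply key
  ring

/-! ## The unknot: complement and oriented tubular neighbourhood -/

section Unknot

variable [SphereEmbedding.SmoothnessFacts]

/-- The unknot in coordinates: `unknot x = (x, 0)`. [folklore] -/
theorem coe_unknot_apply (x : 𝕊 1) : ((unknot x : 𝕊 3) : 𝔼 4) = app x 0 :=
  (app_zero_eq_euclideanInclusion x).symm

/-- A point of `S³` lies on the unknot iff its `tl`-component vanishes. [folklore] -/
theorem mem_range_unknot_iff (p : 𝕊 3) : p ∈ range unknot ↔ tl (p : 𝔼 4) = 0 := by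
  constructor
  · rintro ⟨x, rfl⟩
    rw [coe_unknot_apply, tl_app]
  · intro hp
    have h1 : ‖hd (p : 𝔼 4)‖ = 1 := by
      have h2 := norm_sq_hd_add_norm_sq_tl p
      rw [hp, norm_zero] at h2
      nlinarith [norm_nonneg (hd (p : 𝔼 4))]
    refine ⟨⟨hd (p : 𝔼 4), by simp [h1]⟩, Subtype.ext ?_⟩
    rw [coe_unknot_apply]
    change app (hd (p : 𝔼 4)) 0 = p
    rw [← hp, app_hd_tl]

/-- **The complement of the unknot is `{v ≠ 0}`**, an open solid torus (Rolfsen (1976), §9.G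
Example 3: "the exterior of the unknot is a solid torus"). [folklore] -/
theorem mem_complement_unknot_iff (p : 𝕊 3) : p ∈ unknot.complement ↔ tl (p : 𝔼 4) ≠ 0 := by
  rw [SphereEmbedding.mem_complement_iff, mem_range_unknot_iff]

/-- Points of the complement have non-zero `tl`-component. [folklore] -/
theorem tl_ne_zero_of_complement (a : unknot.complement) : tl ((a : 𝕊 3) : 𝔼 4) ≠ 0 :=
  (mem_complement_unknot_iff _).1 a.2

/-- On the zero section the tube is the unknot: `tube (x, 0) = unknot x`. [folklore] -/
theorem tube_zero (x : 𝕊 1) : tube (x, 0) = unknot x := by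
  apply Subtype.ext
  rw [coe_unknot_apply, coe_tube, tubeVec, NormedSpace.normalize_eq_self_of_norm_eq_one]
  have h := norm_sq_app (x : 𝔼 2) 0
  rw [norm_zero, norm_eq_of_mem_sphere x] at h
  nlinarith [norm_nonneg (app (x : 𝔼 2) 0)]

/-- **The oriented tubular neighbourhood of the unknot** `S¹ × ℝ² ↪ S³`,
`(x, w) ↦ (x, w) / ‖(x, w)‖`: a smooth embedding with `ν (x, 0) = unknot x`, positively oriented
(`det_pos_tube`). [folklore] -/
def unknotTube : Knot.TubularNbhd unknot where
  toFun := tube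
  isSmoothEmbedding := isSmoothEmbedding_tube
  apply_zero := tube_zero
  det_pos := det_pos_tube

/-- The tubular neighbourhood of the unknot is the tube map. [folklore] -/
@[simp] theorem unknotTube_apply (q : (𝕊 1) × 𝔼 2) : unknotTube q = tube q := rfl

end Unknot

/-! ## The tube of the unknot has framing `0` -/

/-- The vector `(q₀, q₁, 1, q₂) ∈ ℝ⁴` attached to `q ∈ ℝ³`: its radial projection parametrises
the open cap `{p₂ > 0}` of `S³`, which misses the unknot. [folklore] -/
def capVec (q : 𝔼 3) : 𝔼 4 := WithLp.toLp 2 ![q 0, q 1, 1, q 2]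

/-- `capVec` is `C^∞` (affine). [folklore] -/
theorem contDiff_capVec : ContDiff ℝ ∞ capVec := by
  unfold capVec
  apply PiLp.contDiff_toLp.comp
  rw [contDiff_pi]
  intro i
  fin_cases i <;> simp <;> fun_prop

/-- The `tl`-component of `capVec q` is `(1, q₂) ≠ 0`. [folklore] -/
theorem tl_capVec_ne_zero (q : 𝔼 3) : tl (capVec q) ≠ 0 := fun h ↦ by
  simpa [capVec] using congrArg (fun v : 𝔼 2 ↦ v 0) h

/-- `capVec q ≠ 0`. [folklore] -/
theorem capVec_ne_zero (q : 𝔼 3) : capVec q ≠ 0 := fun h ↦ by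
  simpa [capVec] using congrArg (fun v : 𝔼 4 ↦ v 2) h

/-- The point `capVec q / ‖capVec q‖` of `S³`. [folklore] -/
def capPoint (q : 𝔼 3) : 𝕊 3 :=
  ⟨NormedSpace.normalize (capVec q), by simp [NormedSpace.norm_normalize (capVec_ne_zero q)]⟩

/-- `capPoint` in coordinates. [folklore] -/
@[simp] theorem coe_capPoint (q : 𝔼 3) :
    (capPoint q : 𝔼 4) = NormedSpace.normalize (capVec q) := rfl

/-- `capPoint` is continuous. [folklore] -/
theorem continuous_capPoint : Continuous capPoint := by
  refine Continuous.subtype_mk ?_ _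
  exact GluckUnknot.contDiffOn_normalize.continuousOn.comp_continuous contDiff_capVec.continuous
    fun q ↦ capVec_ne_zero q

/-- The circle `t ↦ (2 cos t, 2 sin t, 0)` of `ℝ³`, which the cap map sends onto the longitude of
the tube. [folklore] -/
def capCircle (t : ℝ) : 𝔼 3 := WithLp.toLp 2 ![2 * Real.cos t, 2 * Real.sin t, 0]

/-- `capCircle` is continuous. [folklore] -/
theorem continuous_capCircle : Continuous capCircle := by
  unfold capCircle
  refine (PiLp.continuous_toLp 2 _).comp (continuous_pi fun i ↦ ?_)
  fin_cases i <;> simp <;> fun_prop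

/-- `capCircle` is `2π`-periodic at `0`. [folklore] -/
theorem capCircle_two_pi : capCircle (2 * Real.pi) = capCircle 0 := by
  simp [capCircle]

/-- `capVec (capCircle t) = 2 (cos t, sin t, ½, 0)`. [folklore] -/
theorem capVec_capCircle (t : ℝ) :
    capVec (capCircle t) = (2 : ℝ) • app (circlePoint t : 𝔼 2) framingBaseVector := by
  ext i
  fin_cases i <;> simp [capVec, capCircle, app, framingBaseVector]

/-- **The cap map sends the circle onto the longitude of the tube**:
`capPoint (capCircle t) = tube (circlePoint t, e₀)` (the radial projection is scale invariant).
[folklore] -/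
theorem capPoint_capCircle (t : ℝ) :
    capPoint (capCircle t) = tube (circlePoint t, framingBaseVector) := by
  apply Subtype.ext
  rw [coe_capPoint, capVec_capCircle, NormedSpace.normalize_smul_of_pos two_pos, coe_tube, tubeVec]

/-- The base point `(2, 0, 0)` of the parameter space. [folklore] -/
def capBase : (univ : Set (𝔼 3)) := ⟨capCircle 0, mem_univ _⟩

/-- **The circle as a loop in the parameter space** based at `(2, 0, 0)`. [folklore] -/
def capLoop : Path capBase capBase where
  toFun θ := ⟨capCircle (2 * Real.pi * θ), mem_univ _⟩
  continuous_toFun :=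
    (continuous_capCircle.comp (continuous_const.mul continuous_subtype_val)).subtype_mk _
  source' := by
    apply Subtype.ext
    simp only [Set.Icc.coe_zero, mul_zero]
    rfl
  target' := by
    apply Subtype.ext
    simp only [Set.Icc.coe_one, mul_one, capCircle_two_pi]
    rfl

/-- **The circle is null-homotopic in the parameter space** (`ℝ³` is convex, hence contractible
and simply connected). [folklore] -/
theorem capLoop_homotopic_refl : capLoop.Homotopic (Path.refl capBase) := by
  haveI : ContractibleSpace (univ : Set (𝔼 3)) := convex_univ.contractibleSpace ⟨_, capBase.2⟩
  exact SimplyConnectedSpace.paths_homotopic _ _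

section Framing

variable [SphereEmbedding.SmoothnessFacts]

/-- `capPoint q` lies off the unknot. [folklore] -/
theorem capPoint_mem_complement (q : 𝔼 3) : capPoint q ∈ unknot.complement := by
  rw [mem_complement_unknot_iff, coe_capPoint, NormedSpace.normalize, tl_smul]
  exact smul_ne_zero (inv_ne_zero (norm_ne_zero_iff.2 (capVec_ne_zero q))) (tl_capVec_ne_zero q)

/-- **The cap map** `ℝ³ → S³ ∖ U`, `q ↦ (q₀, q₁, 1, q₂) / ‖(q₀, q₁, 1, q₂)‖`, as a continuous map on
the (convex) parameter space `ℝ³` with values in the knot complement. [folklore] -/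
def capMap : C((univ : Set (𝔼 3)), unknot.complement) where
  toFun q := ⟨capPoint q, capPoint_mem_complement q⟩
  continuous_toFun := (continuous_capPoint.comp continuous_subtype_val).subtype_mk _

/-- The cap map on points. [folklore] -/
@[simp] theorem coe_capMap_apply (q : (univ : Set (𝔼 3))) : (capMap q : 𝕊 3) = capPoint q := rfl

/-- The cap map sends the base point to the base point of the tube. [folklore] -/
theorem capMap_capBase : capMap capBase = unknotTube.basePoint := by
  apply Subtype.ext
  rw [coe_capMap_apply, Knot.TubularNbhd.coe_basePoint, unknotTube_apply]
  exact capPoint_capCircle 0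

/-- **The longitude of the tube is the image of the circle under the cap map.** [folklore] -/
theorem longitude_unknotTube : unknotTube.longitude =
    ((capLoop.map capMap.continuous).cast capMap_capBase.symm capMap_capBase.symm) := by
  apply Path.ext
  funext θ
  apply Subtype.ext
  rw [Knot.TubularNbhd.coe_longitude_apply, unknotTube_apply]
  exact (capPoint_capCircle _).symm

/-- **The tube of the unknot has framing `0`**: its longitude is the image of a null-homotopic
loop under a continuous map into the knot complement, so its class in `π₁(S³ ∖ U)ᵃᵇ = H₁(S³ ∖ U)`
is trivial — the push-off `x ↦ ν (x, e₀)` does not link the unknot (Rolfsen (1976), §9.G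
Example 3: `0`-framed longitude = the curve bounding a disc in the exterior). [folklore] -/
theorem hasFraming_unknotTube : unknotTube.HasFraming 0 := by
  unfold Knot.TubularNbhd.HasFraming
  rw [zpow_zero, longitude_unknotTube, Path.Homotopic.Quotient.mk_cast,
    Path.Homotopic.Quotient.mk_map, Path.Homotopic.Quotient.eq.2 capLoop_homotopic_refl,
    ← FundamentalGroup.mapOfEq_apply capMap capMap_capBase, Path.Homotopic.Quotient.mk_refl,
    ← FundamentalGroup.one_def, map_one]
  exact map_one _

end Framing

/-! ## The new solid torus: the cap `σ : ℝ² → S²` around the north pole -/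

/-- The vector `(2p, 1 - ‖p‖²) ∈ ℝ³`. [folklore] -/
def sigmaAux (p : 𝔼 2) : 𝔼 3 := WithLp.toLp 2 ![2 * p 0, 2 * p 1, 1 - ‖p‖ ^ 2]

/-- `‖(2p, 1 - ‖p‖²)‖ = 1 + ‖p‖²`. [folklore] -/
theorem norm_sigmaAux (p : 𝔼 2) : ‖sigmaAux p‖ = 1 + ‖p‖ ^ 2 := by
  have hp := norm_sq_eq_of_fin_two p
  have h : ‖sigmaAux p‖ ^ 2 = (1 + ‖p‖ ^ 2) ^ 2 := by
    have h3 : ‖sigmaAux p‖ ^ 2 = (2 * p 0) ^ 2 + (2 * p 1) ^ 2 + (1 - ‖p‖ ^ 2) ^ 2 := by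
      simp only [sigmaAux, EuclideanSpace.real_norm_sq_eq, Fin.sum_univ_three, Fin.isValue,
        Matrix.cons_val_zero, Matrix.cons_val_one, Matrix.cons_val]
    rw [h3]
    nlinarith [hp]
  exact (sq_eq_sq₀ (norm_nonneg _) (by positivity)).1 h

/-- The map `σ` as a map to `ℝ³`: `σ p = (2p, 1 - ‖p‖²) / (1 + ‖p‖²)`, the inverse stereographic
projection from the south pole (so `σ 0` is the north pole and `σ` maps the open unit disc onto
the open northern hemisphere). [folklore] -/
def sigmaVec (p : 𝔼 2) : 𝔼 3 := (1 + ‖p‖ ^ 2)⁻¹ • sigmaAux p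

/-- `σ` takes unit values. [folklore] -/
theorem norm_sigmaVec (p : 𝔼 2) : ‖sigmaVec p‖ = 1 := by
  rw [sigmaVec, norm_smul, norm_inv, Real.norm_of_nonneg (by positivity), norm_sigmaAux,
    inv_mul_cancel₀ (by positivity)]

/-- **The cap `σ : ℝ² → S²`**, `p ↦ (2p, 1 - ‖p‖²) / (1 + ‖p‖²)`: the meridian discs `D̊² × {v}` of
the new solid torus become the caps `σ(D̊²) × {v}` of `S² × S¹`. [folklore] -/
def sigma (p : 𝔼 2) : 𝕊 2 := ⟨sigmaVec p, by simp [norm_sigmaVec p]⟩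

/-- `σ` in coordinates. [folklore] -/
@[simp] theorem coe_sigma (p : 𝔼 2) : (sigma p : 𝔼 3) = sigmaVec p := rfl

/-- Coordinate `0` of `σ p`. [folklore] -/
theorem sigmaVec_apply_zero (p : 𝔼 2) : sigmaVec p 0 = (1 + ‖p‖ ^ 2)⁻¹ * (2 * p 0) := by
  simp [sigmaVec, sigmaAux]

/-- Coordinate `1` of `σ p`. [folklore] -/
theorem sigmaVec_apply_one (p : 𝔼 2) : sigmaVec p 1 = (1 + ‖p‖ ^ 2)⁻¹ * (2 * p 1) := by
  simp [sigmaVec, sigmaAux]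

/-- Coordinate `2` (the height) of `σ p`. [folklore] -/
theorem sigmaVec_apply_two (p : 𝔼 2) : sigmaVec p 2 = (1 + ‖p‖ ^ 2)⁻¹ * (1 - ‖p‖ ^ 2) := by
  simp [sigmaVec, sigmaAux]

/-- The height of `σ p` is positive on the open unit disc. [folklore] -/
theorem sigmaVec_apply_two_pos {p : 𝔼 2} (hp : ‖p‖ < 1) : 0 < sigmaVec p 2 := by
  rw [sigmaVec_apply_two]
  refine mul_pos (inv_pos.2 (by positivity)) ?_
  nlinarith [norm_nonneg p]

/-- The height of `σ p` exceeds `-1` everywhere. [folklore] -/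
theorem neg_one_lt_sigmaVec_apply_two (p : 𝔼 2) : -1 < sigmaVec p 2 := by
  rw [sigmaVec_apply_two]
  have h : 0 < 1 + ‖p‖ ^ 2 := by positivity
  have h2 : (1 + ‖p‖ ^ 2)⁻¹ * (1 - ‖p‖ ^ 2) = 2 * (1 + ‖p‖ ^ 2)⁻¹ - 1 := by
    field_simp
    ring
  rw [h2]
  linarith [inv_pos.2 h]

/-- `σ` is `C^∞` as a map to `ℝ³`. [folklore] -/
theorem contDiff_sigmaVec : ContDiff ℝ ∞ sigmaVec := by
  have h1 : ContDiff ℝ ∞ fun p : 𝔼 2 ↦ ‖p‖ ^ 2 := contDiff_norm_sq ℝ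
  have h2 : ContDiff ℝ ∞ sigmaAux := by
    unfold sigmaAux
    apply PiLp.contDiff_toLp.comp
    rw [contDiff_pi]
    intro i
    fin_cases i
    · simp; fun_prop
    · simp; fun_prop
    · simpa using contDiff_const.sub h1
  exact ((contDiff_const.add h1).inv fun p ↦ by positivity).smul h2

/-- `σ` is `C^∞` as a map to `S²`. [folklore] -/
theorem contMDiff_sigma : ContMDiff 𝓘(ℝ, 𝔼 2) (𝓡 2) ∞ sigma :=
  contDiff_sigmaVec.contMDiff.codRestrict_sphere fun p ↦ (sigma p).2

/-- The inverse of `σ` (stereographic projection from the south pole): `q ↦ (q₀, q₁) / (1 + q₂)`.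
[folklore] -/
def sigmaInv (q : 𝔼 3) : 𝔼 2 := (1 + q 2)⁻¹ • WithLp.toLp 2 ![q 0, q 1]

/-- Coordinate `0` of `σ⁻¹ q`. [folklore] -/
@[simp] theorem sigmaInv_apply_zero (q : 𝔼 3) : sigmaInv q 0 = (1 + q 2)⁻¹ * q 0 := by
  simp [sigmaInv]

/-- Coordinate `1` of `σ⁻¹ q`. [folklore] -/
@[simp] theorem sigmaInv_apply_one (q : 𝔼 3) : sigmaInv q 1 = (1 + q 2)⁻¹ * q 1 := by
  simp [sigmaInv]

/-- `σ⁻¹ ∘ σ = id` on `ℝ²`. [folklore] -/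
theorem sigmaInv_sigmaVec (p : 𝔼 2) : sigmaInv (sigmaVec p) = p := by
  have h : 0 < 1 + ‖p‖ ^ 2 := by positivity
  have h2 : (1 + sigmaVec p 2)⁻¹ = (1 + ‖p‖ ^ 2) / 2 := by
    rw [sigmaVec_apply_two, ← one_div]
    field_simp
    ring
  ext i
  fin_cases i
  · simp only [Fin.zero_eta, Fin.isValue, sigmaInv_apply_zero, h2, sigmaVec_apply_zero]
    field_simp
  · simp only [Fin.mk_one, Fin.isValue, sigmaInv_apply_one, h2, sigmaVec_apply_one]
    field_simp

/-- `σ` is injective on `ℝ²`. [folklore] -/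
theorem sigma_injective : Injective sigma := fun p p' h ↦ by
  rw [← sigmaInv_sigmaVec p, ← sigmaInv_sigmaVec p', ← coe_sigma, ← coe_sigma, h]

/-- The coordinates of a point of `S²`. [folklore] -/
theorem sphereTwo_coord_sq (q : 𝕊 2) : (q : 𝔼 3) 0 ^ 2 + (q : 𝔼 3) 1 ^ 2 + (q : 𝔼 3) 2 ^ 2 = 1 := by
  have h2 : ‖(q : 𝔼 3)‖ ^ 2 = 1 := by rw [norm_eq_of_mem_sphere q, one_pow]
  rw [EuclideanSpace.real_norm_sq_eq, Fin.sum_univ_three] at h2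
  exact h2

/-- `‖σ⁻¹ q‖² = (1 - q₂) / (1 + q₂)` for `q ∈ S²` off the south pole. [folklore] -/
theorem norm_sq_sigmaInv (q : 𝕊 2) (hq : 0 < 1 + (q : 𝔼 3) 2) :
    ‖sigmaInv (q : 𝔼 3)‖ ^ 2 = (1 - (q : 𝔼 3) 2) / (1 + (q : 𝔼 3) 2) := by
  have hc := sphereTwo_coord_sq q
  rw [norm_sq_eq_of_fin_two, sigmaInv_apply_zero, sigmaInv_apply_one]
  field_simp
  nlinarith [hc]

/-- `σ ∘ σ⁻¹ = id` off the south pole. [folklore] -/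
theorem sigmaVec_sigmaInv (q : 𝕊 2) (hq : 0 < 1 + (q : 𝔼 3) 2) :
    sigmaVec (sigmaInv (q : 𝔼 3)) = q := by
  have hn := norm_sq_sigmaInv q hq
  have h1' : (1 + ‖sigmaInv (q : 𝔼 3)‖ ^ 2)⁻¹ = (1 + (q : 𝔼 3) 2) / 2 := by
    rw [hn, ← one_div]
    field_simp
    ring
  ext i
  fin_cases i
  · simp only [Fin.zero_eta, Fin.isValue, sigmaVec_apply_zero, h1', sigmaInv_apply_zero]
    field_simp
  · simp only [Fin.mk_one, Fin.isValue, sigmaVec_apply_one, h1', sigmaInv_apply_one]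
    field_simp
  · simp only [Fin.reduceFinMk, Fin.isValue, sigmaVec_apply_two, hn]
    field_simp
    ring

/-- `σ⁻¹` is `C^∞` off the plane `{q₂ = -1}`. [folklore] -/
theorem contDiffAt_sigmaInv {q : 𝔼 3} (hq : 1 + q 2 ≠ 0) : ContDiffAt ℝ ∞ sigmaInv q := by
  have h1 : ContDiff ℝ ∞ fun q : 𝔼 3 ↦ (WithLp.toLp 2 ![q 0, q 1] : 𝔼 2) := by
    apply PiLp.contDiff_toLp.comp
    rw [contDiff_pi]
    intro i
    fin_cases i <;> simp <;> fun_prop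
  have h2 : ContDiffAt ℝ ∞ (fun q : 𝔼 3 ↦ 1 + q 2) q := by fun_prop
  exact (h2.inv hq).smul h1.contDiffAt

/-! ## The sphere factor `Φ : S³ ∖ U → S²` of the embedding of the knot complement -/

/-- The first two coordinates of `z ∈ ℝ⁴`, padded: `(z₀, z₁, 0) ∈ ℝ³`. [folklore] -/
def hd3 (z : 𝔼 4) : 𝔼 3 := WithLp.toLp 2 ![z 0, z 1, 0]

/-- `hd3` is `C^∞` (linear). [folklore] -/
theorem contDiff_hd3 : ContDiff ℝ ∞ hd3 := by
  unfold hd3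
  apply PiLp.contDiff_toLp.comp
  rw [contDiff_pi]
  intro i
  fin_cases i <;> simp <;> fun_prop

/-- The vector `Φ z = (2 ‖v‖ y, ‖y‖² - ‖v‖²) ∈ ℝ³` for `z = (y, v) ∈ ℝ² × ℝ²`: on `S³` it is a unit
vector, constant on the circles `{(y, ‖v‖ e^{iφ})}` which `0`-surgery collapses. [folklore] -/
def phiVec (z : 𝔼 4) : 𝔼 3 :=
  (2 * ‖tl z‖) • hd3 z + (‖hd z‖ ^ 2 - ‖tl z‖ ^ 2) • EuclideanSpace.single 2 1

/-- Coordinate `0` of `Φ`. [folklore] -/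
@[simp] theorem phiVec_apply_zero (z : 𝔼 4) : phiVec z 0 = 2 * ‖tl z‖ * z 0 := by
  simp [phiVec, hd3]

/-- Coordinate `1` of `Φ`. [folklore] -/
@[simp] theorem phiVec_apply_one (z : 𝔼 4) : phiVec z 1 = 2 * ‖tl z‖ * z 1 := by
  simp [phiVec, hd3]

/-- Coordinate `2` (the height) of `Φ`. [folklore] -/
@[simp] theorem phiVec_apply_two (z : 𝔼 4) : phiVec z 2 = ‖hd z‖ ^ 2 - ‖tl z‖ ^ 2 := by
  simp [phiVec, hd3]

/-- `‖Φ z‖² = (‖y‖² + ‖v‖²)²`. [folklore] -/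
theorem norm_sq_phiVec (z : 𝔼 4) : ‖phiVec z‖ ^ 2 = (‖hd z‖ ^ 2 + ‖tl z‖ ^ 2) ^ 2 := by
  have h := norm_sq_eq_of_fin_two (hd z)
  simp only [hd_apply_zero, hd_apply_one] at h
  have h3 : ‖phiVec z‖ ^ 2 = (2 * ‖tl z‖ * z 0) ^ 2 + (2 * ‖tl z‖ * z 1) ^ 2
      + (‖hd z‖ ^ 2 - ‖tl z‖ ^ 2) ^ 2 := by
    rw [EuclideanSpace.real_norm_sq_eq, Fin.sum_univ_three, phiVec_apply_zero, phiVec_apply_one,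
      phiVec_apply_two]
  rw [h3]
  nlinarith [h]

/-- On `S³`, `Φ` takes unit values. [folklore] -/
theorem norm_phiVec_coe (p : 𝕊 3) : ‖phiVec (p : 𝔼 4)‖ = 1 := by
  have h : ‖phiVec (p : 𝔼 4)‖ ^ 2 = 1 := by rw [norm_sq_phiVec, norm_sq_hd_add_norm_sq_tl, one_pow]
  rw [← sq_eq_sq₀ (norm_nonneg _) zero_le_one, h, one_pow]

/-- **The sphere factor** `Φ : S³ → S²` of the embedding of the knot complement,
`(y, v) ↦ (2 ‖v‖ y, ‖y‖² - ‖v‖²)`. [folklore] -/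
def phi (p : 𝕊 3) : 𝕊 2 := ⟨phiVec (p : 𝔼 4), by simp [norm_phiVec_coe p]⟩

/-- `Φ` in coordinates. [folklore] -/
@[simp] theorem coe_phi (p : 𝕊 3) : (phi p : 𝔼 3) = phiVec (p : 𝔼 4) := rfl

/-- The height of `Φ p` is `1 - 2 ‖v‖²`. [folklore] -/
theorem phiVec_coe_apply_two (p : 𝕊 3) : phiVec (p : 𝔼 4) 2 = 1 - 2 * ‖tl (p : 𝔼 4)‖ ^ 2 := by
  rw [phiVec_apply_two]
  linarith [norm_sq_hd_add_norm_sq_tl p]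

/-- `Φ` is `C^∞` off the plane `{v = 0}` (the norm is smooth off the origin). [folklore] -/
theorem contDiffAt_phiVec {z : 𝔼 4} (hz : tl z ≠ 0) : ContDiffAt ℝ ∞ phiVec z := by
  have h1 : ContDiffAt ℝ ∞ (fun z ↦ ‖tl z‖) z := contDiff_tl.contDiffAt.norm ℝ hz
  have h2 : ContDiff ℝ ∞ fun z : 𝔼 4 ↦ ‖hd z‖ ^ 2 := contDiff_hd.norm_sq ℝ
  have h3 : ContDiff ℝ ∞ fun z : 𝔼 4 ↦ ‖tl z‖ ^ 2 := contDiff_tl.norm_sq ℝ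
  exact ((contDiffAt_const.mul h1).smul contDiff_hd3.contDiffAt).add
    ((h2.sub h3).contDiffAt.smul contDiffAt_const)

/-- `Φ` is `C^∞` off the plane `{v = 0}`, as a map on `ℝ⁴`. [folklore] -/
theorem contDiffOn_phiVec : ContDiffOn ℝ ∞ phiVec {z | tl z ≠ 0} :=
  fun _ hz ↦ (contDiffAt_phiVec hz).contDiffWithinAt

/-- The set `{v ≠ 0} ⊆ S³` (the complement of the unknot) is open. [folklore] -/
theorem isOpen_tl_ne_zero : IsOpen {p : 𝕊 3 | tl (p : 𝔼 4) ≠ 0} :=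
  isOpen_ne.preimage (contDiff_tl.continuous.comp continuous_subtype_val)

/-- `Φ : S³ → S²` is `C^∞` off the unknot. [folklore] -/
theorem contMDiffOn_phi : ContMDiffOn (𝓡 3) (𝓡 2) ∞ phi {p : 𝕊 3 | tl (p : 𝔼 4) ≠ 0} :=
  contMDiffOn_sphere_of_coe isOpen_tl_ne_zero
    (contDiffOn_phiVec.contMDiffOn.comp contMDiff_coe_sphere.contMDiffOn fun _ hp ↦ hp)

/-! ## The embedding `jB` of the new solid torus `D̊² × S¹ ↪ S² × S¹`, `(p, v) ↦ (σ p, v)` -/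

/-- The height coordinate `q₂` of the `S²`-component, a continuous function on `S² × S¹`.
[folklore] -/
theorem continuous_height : Continuous fun q : (𝕊 2) × (𝕊 1) ↦ (q.1 : 𝔼 3) 2 :=
  (EuclideanSpace.proj (2 : Fin 3)).continuous.comp (continuous_subtype_val.comp continuous_fst)

/-- The open northern part `{q₂ > 0} × S¹` of `S² × S¹` (the image of the new solid torus).
[folklore] -/
theorem isOpen_height_pos : IsOpen {q : (𝕊 2) × (𝕊 1) | 0 < (q.1 : 𝔼 3) 2} :=
  isOpen_lt continuous_const continuous_height

/-- The open part `{q₂ < 1} × S¹ = (S² ∖ {N}) × S¹` of `S² × S¹` (the image of the knot complement).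
[folklore] -/
theorem isOpen_height_lt_one : IsOpen {q : (𝕊 2) × (𝕊 1) | (q.1 : 𝔼 3) 2 < 1} :=
  isOpen_lt continuous_height continuous_const

/-- **The embedding of the new solid torus**: `jB (p, v) = (σ p, v)`. [folklore] -/
def glueB (b : solidTorus) : (𝕊 2) × (𝕊 1) := (sigma (b : 𝔼 2 × (𝕊 1)).1, (b : 𝔼 2 × (𝕊 1)).2)

/-- First component of `jB`. [folklore] -/
@[simp] theorem glueB_fst (b : solidTorus) : (glueB b).1 = sigma (b : 𝔼 2 × (𝕊 1)).1 := rfl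

/-- Second component of `jB`. [folklore] -/
@[simp] theorem glueB_snd (b : solidTorus) : (glueB b).2 = (b : 𝔼 2 × (𝕊 1)).2 := rfl

/-- `jB` is `C^∞`. [folklore] -/
theorem contMDiff_glueB : ContMDiff (𝓘(ℝ, 𝔼 2).prod (𝓡 1)) ((𝓡 2).prod (𝓡 1)) ∞ glueB :=
  (contMDiff_sigma.comp (contMDiff_fst.comp contMDiff_subtype_val)).prodMk
    (contMDiff_snd.comp contMDiff_subtype_val)

/-- `jB` lands in `{q₂ > 0}`. [folklore] -/
theorem glueB_height_pos (b : solidTorus) : 0 < ((glueB b).1 : 𝔼 3) 2 :=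
  sigmaVec_apply_two_pos ((mem_solidTorus_iff _).1 b.2)

/-- The centre `(0, e₀)` of the solid torus (used as a junk value). [folklore] -/
def solidTorusBase : solidTorus := ⟨((0 : 𝔼 2), circlePoint 0), by simp⟩

/-- `‖σ⁻¹ q‖ < 1` on the open northern hemisphere. [folklore] -/
theorem norm_sigmaInv_lt_one (q : 𝕊 2) (hq : 0 < (q : 𝔼 3) 2) : ‖sigmaInv (q : 𝔼 3)‖ < 1 := by
  have hn := norm_sq_sigmaInv q (by linarith)
  have h1 : ‖sigmaInv (q : 𝔼 3)‖ ^ 2 < 1 := by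
    rw [hn, div_lt_one (by linarith)]
    linarith
  exact (pow_lt_one_iff_of_nonneg (norm_nonneg _) two_ne_zero).1 h1

/-- The inverse of `jB`: `(q, v) ↦ (σ⁻¹ q, v)` on `{q₂ > 0}` (junk value elsewhere). [folklore] -/
def glueBInv (q : (𝕊 2) × (𝕊 1)) : solidTorus :=
  if h : 0 < (q.1 : 𝔼 3) 2 then
    ⟨(sigmaInv (q.1 : 𝔼 3), q.2), by rw [mem_solidTorus_iff]; exact norm_sigmaInv_lt_one q.1 h⟩
  else solidTorusBase

/-- `glueBInv` on `{q₂ > 0}`. [folklore] -/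
theorem coe_glueBInv {q : (𝕊 2) × (𝕊 1)} (hq : 0 < (q.1 : 𝔼 3) 2) :
    ((glueBInv q : solidTorus) : 𝔼 2 × (𝕊 1)) = (sigmaInv (q.1 : 𝔼 3), q.2) := by
  simp [glueBInv, hq]

/-- `glueBInv ∘ jB = id`. [folklore] -/
theorem glueBInv_glueB (b : solidTorus) : glueBInv (glueB b) = b := by
  apply Subtype.ext
  rw [coe_glueBInv (glueB_height_pos b), glueB_fst, glueB_snd, coe_sigma, sigmaInv_sigmaVec]

/-- `jB ∘ glueBInv = id` on `{q₂ > 0}`. [folklore] -/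
theorem glueB_glueBInv {q : (𝕊 2) × (𝕊 1)} (hq : 0 < (q.1 : 𝔼 3) 2) : glueB (glueBInv q) = q := by
  have h := coe_glueBInv hq
  refine Prod.ext (Subtype.ext ?_) ?_
  · rw [glueB_fst, h, coe_sigma, sigmaVec_sigmaInv q.1 (by linarith)]
  · rw [glueB_snd, h]

/-- `glueBInv` is `C^∞` on `{q₂ > 0}` (as a map into the open solid torus). [folklore] -/
theorem contMDiffOn_glueBInv : ContMDiffOn ((𝓡 2).prod (𝓡 1)) (𝓘(ℝ, 𝔼 2).prod (𝓡 1)) ∞ glueBInv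
    {q : (𝕊 2) × (𝕊 1) | 0 < (q.1 : 𝔼 3) 2} := by
  have key : ContMDiffOn ((𝓡 2).prod (𝓡 1)) (𝓘(ℝ, 𝔼 2).prod (𝓡 1)) ∞
      (fun q : (𝕊 2) × (𝕊 1) ↦ (sigmaInv (q.1 : 𝔼 3), q.2)) {q | 0 < (q.1 : 𝔼 3) 2} := by
    refine ContMDiffOn.prodMk (fun q hq ↦ ?_) contMDiff_snd.contMDiffOn
    have h1 : ContMDiff ((𝓡 2).prod (𝓡 1)) 𝓘(ℝ, 𝔼 3) ∞ (fun q : (𝕊 2) × (𝕊 1) ↦ (q.1 : 𝔼 3)) :=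
      contMDiff_coe_sphere.comp contMDiff_fst
    have h2 : (1 : ℝ) + (q.1 : 𝔼 3) 2 ≠ 0 := by
      have : (0 : ℝ) < (q.1 : 𝔼 3) 2 := hq
      linarith
    exact ((contDiffAt_sigmaInv h2).contMDiffAt.comp q (h1 q)).contMDiffWithinAt
  intro q hq
  rw [← ContMDiffWithinAt.subtypeVal_comp_iff]
  refine (key q hq).congr (fun y hy ↦ ?_) ?_
  · exact coe_glueBInv hy
  · exact coe_glueBInv hq

/-- **The new solid torus as an open partial homeomorphism** `D̊² × S¹ ⇀ S² × S¹` with source `univ`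
and target `{q₂ > 0} × S¹`. [folklore] -/
def glueBHomeomorph : OpenPartialHomeomorph solidTorus ((𝕊 2) × (𝕊 1)) where
  toFun := glueB
  invFun := glueBInv
  source := univ
  target := {q | 0 < (q.1 : 𝔼 3) 2}
  map_source' b _ := glueB_height_pos b
  map_target' _ _ := mem_univ _
  left_inv' b _ := glueBInv_glueB b
  right_inv' _ hq := glueB_glueBInv hq
  open_source := isOpen_univ
  open_target := isOpen_height_pos
  continuousOn_toFun := contMDiff_glueB.continuous.continuousOn
  continuousOn_invFun := contMDiffOn_glueBInv.continuousOn

/-- **`jB` is a smooth embedding** `D̊² × S¹ ↪ S² × S¹` (a globally defined partial diffeomorphism,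
`Literature.Topology.FourManifolds.isSmoothEmbedding_of_openPartialHomeomorph`). [folklore] -/
theorem isSmoothEmbedding_glueB :
    Manifold.IsSmoothEmbedding (𝓘(ℝ, 𝔼 2).prod (𝓡 1)) ((𝓡 2).prod (𝓡 1)) ∞ glueB :=
  isSmoothEmbedding_of_openPartialHomeomorph glueBHomeomorph rfl contMDiff_glueB.contMDiffOn
    contMDiffOn_glueBInv (ContinuousLinearEquiv.refl ℝ _)

/-- The image of `jB` is `{q₂ > 0} × S¹`. [folklore] -/
theorem range_glueB : range glueB = {q : (𝕊 2) × (𝕊 1) | 0 < (q.1 : 𝔼 3) 2} := by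
  rw [← image_univ]
  exact glueBHomeomorph.image_source_eq_target

/-! ## The embedding `jA` of the knot complement `S³ ∖ U ↪ S² × S¹`, `a ↦ (Φ a, v / ‖v‖)` -/

section GlueA

variable [SphereEmbedding.SmoothnessFacts]

/-- **The embedding of the knot complement**: `jA (y, v) = (Φ (y, v), v / ‖v‖)`. [folklore] -/
def glueA (a : unknot.complement) : (𝕊 2) × (𝕊 1) :=
  (phi (a : 𝕊 3), circleProj (tl ((a : 𝕊 3) : 𝔼 4)))

/-- First component of `jA`. [folklore] -/
@[simp] theorem glueA_fst (a : unknot.complement) : (glueA a).1 = phi (a : 𝕊 3) := rfl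

/-- Second component of `jA`. [folklore] -/
@[simp] theorem glueA_snd (a : unknot.complement) :
    (glueA a).2 = circleProj (tl ((a : 𝕊 3) : 𝔼 4)) := rfl

/-- `jA` is `C^∞`. [folklore] -/
theorem contMDiff_glueA : ContMDiff (𝓡 3) ((𝓡 2).prod (𝓡 1)) ∞ glueA :=
  (contMDiffOn_phi.comp_contMDiff contMDiff_subtype_val tl_ne_zero_of_complement).prodMk
    (contMDiffOn_circleProj.comp_contMDiff
      ((contDiff_tl.contMDiff.comp contMDiff_coe_sphere).comp contMDiff_subtype_val)
      tl_ne_zero_of_complement)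

/-- `jA` lands in `{q₂ < 1}`. [folklore] -/
theorem glueA_height_lt_one (a : unknot.complement) : ((glueA a).1 : 𝔼 3) 2 < 1 := by
  rw [glueA_fst, coe_phi, phiVec_coe_apply_two]
  have h : 0 < ‖tl ((a : 𝕊 3) : 𝔼 4)‖ := norm_pos_iff.2 (tl_ne_zero_of_complement a)
  nlinarith

/-- The radius `r(q) = √((1 - q₂) / 2)` of the `v`-component of `jA⁻¹ (q, ·)`. [folklore] -/
def rA (q : 𝔼 3) : ℝ := Real.sqrt ((1 - q 2) / 2)

omit [SphereEmbedding.SmoothnessFacts] in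
/-- `r(q) > 0` for `q₂ < 1`. [folklore] -/
theorem rA_pos {q : 𝔼 3} (hq : q 2 < 1) : 0 < rA q := Real.sqrt_pos.2 (by linarith)

omit [SphereEmbedding.SmoothnessFacts] in
/-- `r(q)² = (1 - q₂) / 2` for `q₂ < 1`. [folklore] -/
theorem rA_sq {q : 𝔼 3} (hq : q 2 < 1) : rA q ^ 2 = (1 - q 2) / 2 := Real.sq_sqrt (by linarith)

/-- The inverse of `jA` as a map to `ℝ⁴`: `(q, v) ↦ ((q₀, q₁) / (2 r), r v)`, `r = √((1 - q₂) / 2)`.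
[folklore] -/
def glueAInvVec (q : 𝔼 3) (v : 𝔼 2) : 𝔼 4 :=
  app ((2 * rA q)⁻¹ • WithLp.toLp 2 ![q 0, q 1]) (rA q • v)

omit [SphereEmbedding.SmoothnessFacts] in
/-- The `hd`-component of `jA⁻¹ (q, v)`. [folklore] -/
theorem hd_glueAInvVec (q : 𝔼 3) (v : 𝔼 2) :
    hd (glueAInvVec q v) = (2 * rA q)⁻¹ • WithLp.toLp 2 ![q 0, q 1] := by
  rw [glueAInvVec, hd_app]

omit [SphereEmbedding.SmoothnessFacts] in
/-- The `tl`-component of `jA⁻¹ (q, v)`. [folklore] -/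
theorem tl_glueAInvVec (q : 𝔼 3) (v : 𝔼 2) : tl (glueAInvVec q v) = rA q • v := by
  rw [glueAInvVec, tl_app]

omit [SphereEmbedding.SmoothnessFacts] in
/-- `‖hd (jA⁻¹ (q, v))‖² = (1 + q₂) / 2` for `q ∈ S²`, `q₂ < 1`. [folklore] -/
theorem norm_sq_hd_glueAInvVec (q : 𝕊 2) (v : 𝔼 2) (hq : (q : 𝔼 3) 2 < 1) :
    ‖hd (glueAInvVec (q : 𝔼 3) v)‖ ^ 2 = (1 + (q : 𝔼 3) 2) / 2 := by
  have hc := sphereTwo_coord_sq q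
  have hr := rA_sq hq
  have hr0 := rA_pos hq
  rw [hd_glueAInvVec, norm_smul, mul_pow, norm_inv, inv_pow, norm_mul, Real.norm_two,
    Real.norm_of_nonneg hr0.le, norm_sq_eq_of_fin_two]
  simp only [Matrix.cons_val_zero, Matrix.cons_val_one, Matrix.cons_val_fin_one, Fin.isValue]
  field_simp
  nlinarith [hc, hr]

omit [SphereEmbedding.SmoothnessFacts] in
/-- `‖tl (jA⁻¹ (q, v))‖ = r(q)` for `v ∈ S¹`, `q₂ < 1`. [folklore] -/
theorem norm_tl_glueAInvVec (q : 𝔼 3) (v : 𝕊 1) (hq : q 2 < 1) :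
    ‖tl (glueAInvVec q v)‖ = rA q := by
  rw [tl_glueAInvVec, norm_smul, norm_eq_of_mem_sphere v, mul_one, Real.norm_of_nonneg (rA_pos hq).le]

omit [SphereEmbedding.SmoothnessFacts] in
/-- `jA⁻¹ (q, v)` is a unit vector for `q ∈ S²`, `v ∈ S¹`, `q₂ < 1`. [folklore] -/
theorem norm_glueAInvVec (q : 𝕊 2) (v : 𝕊 1) (hq : (q : 𝔼 3) 2 < 1) :
    ‖glueAInvVec (q : 𝔼 3) v‖ = 1 := by
  have h : ‖glueAInvVec (q : 𝔼 3) v‖ ^ 2 = 1 := by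
    rw [norm_sq_eq_hd_tl, norm_sq_hd_glueAInvVec q v hq, norm_tl_glueAInvVec _ v hq, rA_sq hq]
    ring
  rw [← sq_eq_sq₀ (norm_nonneg _) zero_le_one, h, one_pow]

/-- A base point of the complement of the unknot: `(0, 0, 1, 0)` (used as a junk value).
[folklore] -/
def complementBase : unknot.complement :=
  ⟨⟨EuclideanSpace.single 2 1, by simp⟩, by
    rw [mem_complement_unknot_iff]
    intro h
    have h1 := congrArg (fun v : 𝔼 2 ↦ v 0) h
    simp at h1⟩

/-- The inverse of `jA`: `(q, v) ↦ ((q₀, q₁) / (2r), r v)` on `{q₂ < 1}` (junk value elsewhere).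
[folklore] -/
def glueAInv (q : (𝕊 2) × (𝕊 1)) : unknot.complement :=
  if h : (q.1 : 𝔼 3) 2 < 1 then
    ⟨⟨glueAInvVec (q.1 : 𝔼 3) q.2, by simp [norm_glueAInvVec q.1 q.2 h]⟩, by
      rw [mem_complement_unknot_iff]
      change tl (glueAInvVec (q.1 : 𝔼 3) q.2) ≠ 0
      rw [tl_glueAInvVec]
      exact smul_ne_zero (rA_pos h).ne' (ne_zero_of_mem_unit_sphere q.2)⟩
  else complementBase

/-- `glueAInv` on `{q₂ < 1}`, in coordinates. [folklore] -/
theorem coe_glueAInv {q : (𝕊 2) × (𝕊 1)} (hq : (q.1 : 𝔼 3) 2 < 1) :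
    (((glueAInv q : unknot.complement) : 𝕊 3) : 𝔼 4) = glueAInvVec (q.1 : 𝔼 3) q.2 := by
  simp [glueAInv, hq]

omit [SphereEmbedding.SmoothnessFacts] in
/-- The first two coordinates of `Φ a` are `2 ‖v‖ y`. [folklore] -/
theorem toLp_phiVec (z : 𝔼 4) :
    (WithLp.toLp 2 ![phiVec z 0, phiVec z 1] : 𝔼 2) = (2 * ‖tl z‖) • hd z := by
  ext i
  fin_cases i <;> simp [hd]

/-- `glueAInv ∘ jA = id`: `r (Φ a) = ‖v‖`, so `jA⁻¹ (jA (y, v)) = (2‖v‖ y / (2 ‖v‖), ‖v‖ v / ‖v‖)`.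
[folklore] -/
theorem glueAInv_glueA (a : unknot.complement) : glueAInv (glueA a) = a := by
  have ha := tl_ne_zero_of_complement a
  have hn : 0 < ‖tl ((a : 𝕊 3) : 𝔼 4)‖ := norm_pos_iff.2 ha
  have hlt := glueA_height_lt_one a
  have hr : rA ((phi (a : 𝕊 3) : 𝕊 2) : 𝔼 3) = ‖tl ((a : 𝕊 3) : 𝔼 4)‖ := by
    rw [rA, coe_phi, phiVec_coe_apply_two]
    rw [show (1 - (1 - 2 * ‖tl ((a : 𝕊 3) : 𝔼 4)‖ ^ 2)) / 2 = ‖tl ((a : 𝕊 3) : 𝔼 4)‖ ^ 2 by ring]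
    exact Real.sqrt_sq hn.le
  apply Subtype.ext
  apply Subtype.ext
  rw [coe_glueAInv hlt, glueA_fst, glueA_snd, glueAInvVec, hr, coe_phi, toLp_phiVec,
    norm_smul_coe_circleProj ha, smul_smul, inv_mul_cancel₀ (by positivity), one_smul, app_hd_tl]

/-- `jA ∘ glueAInv = id` on `{q₂ < 1}`. [folklore] -/
theorem glueA_glueAInv {q : (𝕊 2) × (𝕊 1)} (hq : (q.1 : 𝔼 3) 2 < 1) : glueA (glueAInv q) = q := by
  have h := coe_glueAInv hq
  have hr0 := rA_pos hq
  have hr := rA_sq hq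
  have htl : tl (((glueAInv q : unknot.complement) : 𝕊 3) : 𝔼 4) = rA (q.1 : 𝔼 3) • (q.2 : 𝔼 2) := by
    rw [h, tl_glueAInvVec]
  have hntl : ‖tl (((glueAInv q : unknot.complement) : 𝕊 3) : 𝔼 4)‖ = rA (q.1 : 𝔼 3) := by
    rw [h, norm_tl_glueAInvVec _ _ hq]
  have hnhd : ‖hd (((glueAInv q : unknot.complement) : 𝕊 3) : 𝔼 4)‖ ^ 2 = (1 + (q.1 : 𝔼 3) 2) / 2 := by
    rw [h, norm_sq_hd_glueAInvVec q.1 q.2 hq]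
  refine Prod.ext (Subtype.ext ?_) ?_
  · rw [glueA_fst, coe_phi]
    ext i
    fin_cases i
    · rw [Fin.zero_eta, phiVec_apply_zero, hntl, ← hd_apply_zero, h, hd_glueAInvVec]
      simp only [PiLp.smul_apply, smul_eq_mul, Matrix.cons_val_zero, Fin.isValue]
      field_simp
    · rw [Fin.mk_one, phiVec_apply_one, hntl, ← hd_apply_one, h, hd_glueAInvVec]
      simp only [PiLp.smul_apply, smul_eq_mul, Matrix.cons_val_one, Matrix.cons_val_zero, Fin.isValue]
      field_simp
    · simp only [Fin.reduceFinMk, phiVec_apply_two, hnhd, hntl, hr, Fin.isValue]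
      ring
  · rw [glueA_snd, htl, circleProj_smul_coe hr0]

omit [SphereEmbedding.SmoothnessFacts] in
/-- `jA⁻¹` is `C^∞` as a map `ℝ³ × ℝ² → ℝ⁴` at points with `q₂ < 1`. [folklore] -/
theorem contDiffAt_glueAInvVec {q : 𝔼 3} (hq : q 2 < 1) (v : 𝔼 2) :
    ContDiffAt ℝ ∞ (fun z : 𝔼 3 × 𝔼 2 ↦ glueAInvVec z.1 z.2) (q, v) := by
  have h1 : ContDiffAt ℝ ∞ (fun z : 𝔼 3 × 𝔼 2 ↦ rA z.1) (q, v) := by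
    have h : ContDiffAt ℝ ∞ (fun z : 𝔼 3 × 𝔼 2 ↦ (1 - z.1 2) / 2) (q, v) := by fun_prop
    exact h.sqrt (by simp only; intro h'; linarith [h'])
  have h2 : ContDiff ℝ ∞ fun z : 𝔼 3 × 𝔼 2 ↦ (WithLp.toLp 2 ![z.1 0, z.1 1] : 𝔼 2) := by
    apply PiLp.contDiff_toLp.comp
    rw [contDiff_pi]
    intro i
    fin_cases i <;> simp <;> fun_prop
  have h3 : ContDiffAt ℝ ∞ (fun z : 𝔼 3 × 𝔼 2 ↦ (2 * rA z.1)⁻¹ • (WithLp.toLp 2 ![z.1 0, z.1 1] : 𝔼 2))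
      (q, v) :=
    ((contDiffAt_const.mul h1).inv (mul_ne_zero two_ne_zero (rA_pos hq).ne')).smul h2.contDiffAt
  have h4 : ContDiffAt ℝ ∞ (fun z : 𝔼 3 × 𝔼 2 ↦ rA z.1 • z.2) (q, v) := h1.smul contDiffAt_snd
  exact contDiff_app.contDiffAt.comp (q, v) (h3.prodMk h4)

/-- `glueAInv` is `C^∞` on `{q₂ < 1}` (as a map into the open submanifold `S³ ∖ U`). [folklore] -/
theorem contMDiffOn_glueAInv : ContMDiffOn ((𝓡 2).prod (𝓡 1)) (𝓡 3) ∞ glueAInv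
    {q : (𝕊 2) × (𝕊 1) | (q.1 : 𝔼 3) 2 < 1} := by
  -- the `ℝ⁴`-valued map is smooth on the target
  have h1 : ContMDiff ((𝓡 2).prod (𝓡 1)) 𝓘(ℝ, 𝔼 3 × 𝔼 2) ∞
      (fun q : (𝕊 2) × (𝕊 1) ↦ ((q.1 : 𝔼 3), (q.2 : 𝔼 2))) :=
    (contMDiff_coe_sphere.comp contMDiff_fst).prodMk_space (contMDiff_coe_sphere.comp contMDiff_snd)
  have h2 : ContMDiffOn ((𝓡 2).prod (𝓡 1)) 𝓘(ℝ, 𝔼 4) ∞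
      (fun q : (𝕊 2) × (𝕊 1) ↦ glueAInvVec (q.1 : 𝔼 3) q.2) {q | (q.1 : 𝔼 3) 2 < 1} :=
    fun q hq ↦ ((contDiffAt_glueAInvVec hq _).contMDiffAt.comp q (h1 q)).contMDiffWithinAt
  -- hence so is the `S³`-valued map
  have h3 : ContMDiffOn ((𝓡 2).prod (𝓡 1)) (𝓡 3) ∞
      (fun q : (𝕊 2) × (𝕊 1) ↦ ((glueAInv q : unknot.complement) : 𝕊 3))
      {q | (q.1 : 𝔼 3) 2 < 1} := by
    apply contMDiffOn_sphere_of_coe isOpen_height_lt_one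
    exact h2.congr fun q hq ↦ coe_glueAInv hq
  intro q hq
  rw [← ContMDiffWithinAt.subtypeVal_comp_iff]
  exact h3 q hq

/-- **The knot complement as an open partial homeomorphism** `S³ ∖ U ⇀ S² × S¹` with source
`univ` and target `{q₂ < 1} × S¹`. [folklore] -/
def glueAHomeomorph : OpenPartialHomeomorph unknot.complement ((𝕊 2) × (𝕊 1)) where
  toFun := glueA
  invFun := glueAInv
  source := univ
  target := {q | (q.1 : 𝔼 3) 2 < 1}
  map_source' a _ := glueA_height_lt_one a
  map_target' _ _ := mem_univ _
  left_inv' a _ := glueAInv_glueA a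
  right_inv' _ hq := glueA_glueAInv hq
  open_source := isOpen_univ
  open_target := isOpen_height_lt_one
  continuousOn_toFun := contMDiff_glueA.continuous.continuousOn
  continuousOn_invFun := contMDiffOn_glueAInv.continuousOn

/-- **`jA` is a smooth embedding** `S³ ∖ U ↪ S² × S¹` (a globally defined partial diffeomorphism
between 3-manifolds, `Literature.Topology.FourManifolds.isSmoothEmbedding_of_openPartialHomeomorph`).
[folklore] -/
theorem isSmoothEmbedding_glueA : Manifold.IsSmoothEmbedding (𝓡 3) ((𝓡 2).prod (𝓡 1)) ∞ glueA :=
  isSmoothEmbedding_of_openPartialHomeomorph glueAHomeomorph rfl contMDiff_glueA.contMDiffOn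
    contMDiffOn_glueAInv (ContinuousLinearEquiv.ofFinrankEq (by simp))

/-- The image of `jA` is `{q₂ < 1} × S¹`. [folklore] -/
theorem range_glueA : range glueA = {q : (𝕊 2) × (𝕊 1) | (q.1 : 𝔼 3) 2 < 1} := by
  rw [← image_univ]
  exact glueAHomeomorph.image_source_eq_target

end GlueA

/-! ## The gluing relation: `jA (tube (u, s v)) = jB (s u, v)` -/

/-- `‖s v‖ = s` for `v ∈ S¹`, `s ≥ 0`. [folklore] -/
theorem norm_smul_coe_sphere {s : ℝ} (hs : 0 ≤ s) (v : 𝕊 1) : ‖s • (v : 𝔼 2)‖ = s := by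
  rw [norm_smul, norm_eq_of_mem_sphere v, mul_one, Real.norm_of_nonneg hs]

/-- `rad (s v)² = 1 + s²` for `v ∈ S¹`. [folklore] -/
theorem rad_smul_coe_sq (s : ℝ) (v : 𝕊 1) : rad (s • (v : 𝔼 2)) ^ 2 = 1 + s ^ 2 := by
  rw [rad_sq, norm_smul, mul_pow, norm_eq_of_mem_sphere v, one_pow, mul_one, Real.norm_eq_abs,
    sq_abs]

/-- The `hd`-component of a point of the tube. [folklore] -/
theorem hd_coe_tube (x : 𝕊 1) (w : 𝔼 2) : hd ((tube (x, w) : 𝕊 3) : 𝔼 4) = (rad w)⁻¹ • (x : 𝔼 2) := by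
  rw [coe_tube_eq, hd_smul, hd_app]

/-- The `tl`-component of a point of the tube. [folklore] -/
theorem tl_coe_tube (x : 𝕊 1) (w : 𝔼 2) : tl ((tube (x, w) : 𝕊 3) : 𝔼 4) = (rad w)⁻¹ • w := by
  rw [coe_tube_eq, tl_smul, tl_app]

/-- **Key identity, `S²`-factor**: `Φ (tube (u, s v)) = σ (s u)` for `u, v ∈ S¹`, `s ≥ 0` — the
`S²`-coordinate of a point of the punctured tube only depends on its angular `y`-coordinate `u` and
its distance `s` from the unknot, exactly as the cap `σ` of the new meridian disc prescribes.
[folklore] -/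
theorem phi_tube (u v : 𝕊 1) {s : ℝ} (hs : 0 ≤ s) :
    phi (tube (u, s • (v : 𝔼 2))) = sigma (s • (u : 𝔼 2)) := by
  set r := rad (s • (v : 𝔼 2)) with hr_def
  have hr0 : 0 < r := rad_pos _
  have hr2 : r ^ 2 = 1 + s ^ 2 := rad_smul_coe_sq s v
  have hsu : ‖s • (u : 𝔼 2)‖ ^ 2 = s ^ 2 := by rw [norm_smul_coe_sphere hs u]
  have htl : ‖tl ((tube (u, s • (v : 𝔼 2)) : 𝕊 3) : 𝔼 4)‖ = r⁻¹ * s := by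
    rw [tl_coe_tube, norm_smul, norm_inv, Real.norm_of_nonneg hr0.le, norm_smul_coe_sphere hs v]
  have hhd : ‖hd ((tube (u, s • (v : 𝔼 2)) : 𝕊 3) : 𝔼 4)‖ = r⁻¹ := by
    rw [hd_coe_tube, norm_smul, norm_inv, Real.norm_of_nonneg hr0.le, norm_eq_of_mem_sphere u, mul_one]
  have h0 : ((tube (u, s • (v : 𝔼 2)) : 𝕊 3) : 𝔼 4) 0 = r⁻¹ * (u : 𝔼 2) 0 := by
    rw [← hd_apply_zero, hd_coe_tube, PiLp.smul_apply, smul_eq_mul]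
  have h1 : ((tube (u, s • (v : 𝔼 2)) : 𝕊 3) : 𝔼 4) 1 = r⁻¹ * (u : 𝔼 2) 1 := by
    rw [← hd_apply_one, hd_coe_tube, PiLp.smul_apply, smul_eq_mul]
  have hinv : (1 + s ^ 2)⁻¹ = r⁻¹ ^ 2 := by rw [inv_pow, hr2]
  apply Subtype.ext
  rw [coe_phi, coe_sigma]
  ext i
  fin_cases i
  · rw [Fin.zero_eta, phiVec_apply_zero, sigmaVec_apply_zero, htl, h0, hsu, hinv, PiLp.smul_apply,
      smul_eq_mul]
    ring
  · rw [Fin.mk_one, phiVec_apply_one, sigmaVec_apply_one, htl, h1, hsu, hinv, PiLp.smul_apply,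
      smul_eq_mul]
    ring
  · simp only [Fin.reduceFinMk, phiVec_apply_two, sigmaVec_apply_two, hhd, htl, hsu, hinv]
    ring

/-- **Key identity, `S¹`-factor**: the angular `v`-coordinate of `tube (u, s v)` is `v` (`s > 0`).
[folklore] -/
theorem circleProj_tl_tube (u v : 𝕊 1) {s : ℝ} (hs : 0 < s) :
    circleProj (tl ((tube (u, s • (v : 𝔼 2)) : 𝕊 3) : 𝔼 4)) = v := by
  rw [tl_coe_tube, smul_smul]
  exact circleProj_smul_coe (mul_pos (inv_pos.2 (rad_pos _)) hs) v

section Relation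

variable [SphereEmbedding.SmoothnessFacts]

/-- A point of the punctured tube lies off the unknot. [folklore] -/
theorem tube_mem_complement (u : 𝕊 1) {w : 𝔼 2} (hw : w ≠ 0) : tube (u, w) ∈ unknot.complement := by
  rw [mem_complement_unknot_iff, coe_tube]
  exact (tl_tubeVec_ne_zero_iff (u, w)).2 hw

/-- **The gluing relation of `0`-surgery on the unknot.** For `a ∈ S³ ∖ U` and `b = (p, v)` in the
open solid torus, `jA a = jB b` iff `p = t u`, `a = ν (u, t v)` for some `u ∈ S¹`, `0 < t < 1`
(`surgeryRel ν a b` for the tube `ν`): the punctured meridian discs `{(t u, v)}` of the new solid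
torus are glued onto the punctured annuli `{ν (u, t v)}` bounded by the `0`-framed longitudes.
[folklore] -/
theorem glueA_eq_glueB_iff (a : unknot.complement) (b : solidTorus) :
    glueA a = glueB b ↔ surgeryRel unknotTube a b := by
  constructor
  · intro h
    have h1 : phi (a : 𝕊 3) = sigma (b : 𝔼 2 × (𝕊 1)).1 := congrArg Prod.fst h
    have h2 : circleProj (tl ((a : 𝕊 3) : 𝔼 4)) = (b : 𝔼 2 × (𝕊 1)).2 := congrArg Prod.snd h
    have ha := tl_ne_zero_of_complement a
    -- the `hd`-component of `a` does not vanish: otherwise `Φ a` would be the south pole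
    have hhd : hd ((a : 𝕊 3) : 𝔼 4) ≠ 0 := by
      intro h0
      have h3 := congrArg (fun q : 𝕊 2 ↦ (q : 𝔼 3) 2) h1
      simp only [coe_phi, phiVec_apply_two, h0, norm_zero, coe_sigma] at h3
      have h4 := norm_sq_hd_add_norm_sq_tl (a : 𝕊 3)
      rw [h0, norm_zero] at h4
      have h5 := neg_one_lt_sigmaVec_apply_two (b : 𝔼 2 × (𝕊 1)).1
      rw [← h3] at h5
      nlinarith [h4, h5]
    -- so `a = tube (u, w)` with `w ≠ 0`, `w = s v'`
    set u := circleProj (hd ((a : 𝕊 3) : 𝔼 4)) with hu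
    set w := ‖hd ((a : 𝕊 3) : 𝔼 4)‖⁻¹ • tl ((a : 𝕊 3) : 𝔼 4) with hw
    have hat : tube (u, w) = a := tube_tubeInv hhd
    have hw0 : w ≠ 0 := smul_ne_zero (inv_ne_zero (norm_ne_zero_iff.2 hhd)) ha
    set s := ‖w‖ with hs
    have hs0 : 0 < s := norm_pos_iff.2 hw0
    set v' := circleProj w with hv'
    have hwv : w = s • (v' : 𝔼 2) := (norm_smul_coe_circleProj hw0).symm
    rw [hwv] at hat
    -- read off the two factors of `jA a`
    rw [← hat, phi_tube u v' hs0.le] at h1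
    rw [← hat, circleProj_tl_tube u v' hs0] at h2
    have hp : s • (u : 𝔼 2) = (b : 𝔼 2 × (𝕊 1)).1 := sigma_injective h1
    have hs1 : s < 1 := by
      have hb := (mem_solidTorus_iff _).1 b.2
      rwa [← hp, norm_smul_coe_sphere hs0.le] at hb
    refine ⟨u, s, ⟨hs0, hs1⟩, hp.symm, ?_⟩
    rw [unknotTube_apply, ← h2]
    exact hat.symm
  · rintro ⟨u, t, ht, hb, hat⟩
    rw [unknotTube_apply] at hat
    refine Prod.ext ?_ ?_
    · rw [glueA_fst, glueB_fst, hat, phi_tube u _ ht.1.le, ← hb]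
    · rw [glueA_snd, glueB_snd, hat, circleProj_tl_tube u _ ht.1]

/-- **The two pieces cover `S² × S¹`**: `{q₂ < 1} ∪ {q₂ > 0}` is everything. [folklore] -/
theorem range_glueA_union_range_glueB : range glueA ∪ range glueB = univ := by
  rw [range_glueA, range_glueB, eq_univ_iff_forall]
  intro q
  by_cases h : (q.1 : 𝔼 3) 2 < 1
  · exact Or.inl h
  · exact Or.inr (lt_of_lt_of_le zero_lt_one (not_lt.1 h))

end Relation

end SurgeryUnknot

/-! ## The discharge -/

open SurgeryUnknot in
variable [SphereEmbedding.SmoothnessFacts] in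
/-- **`0`-surgery on the unknot is `S² × S¹`** (Rolfsen, *Knots and Links* (1976), §9.G Example 3;
Kirby, *The Topology of 4-Manifolds* (1989), Ch. I §2: "Adding a 2-handle to an unknot with zero
framing gives `S² × B²`, also with boundary `S¹ × S²`"; Gompf–Stipsicz (1999), §5.3: the exterior of
the unknot is a solid torus whose meridian discs are bounded by the `0`-framed longitudes, and two
solid tori glued meridian-to-meridian give `S² × S¹`). Discharges the named fact
`Literature.Topology.FourManifolds.isIntegralSurgery_unknot_zero`
(`IsIntegralSurgery ((𝓡 2).prod (𝓡 1)) (𝕊 2 × 𝕊 1) unknot 0`): the oriented tubular neighbourhood is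
the tube `ν (x, w) = (x, w) / ‖(x, w)‖` (`SurgeryUnknot.unknotTube`, positively oriented by
`SurgeryUnknot.det_pos_tube`), of framing `0` (`SurgeryUnknot.hasFraming_unknotTube`: its longitude
bounds in the simply connected cap `{p₂ > 0} ⊆ S³ ∖ U`); the open smooth embedding of the knot
complement `S³ ∖ U = {v ≠ 0}` is `jA (y, v) = ((2‖v‖ y, ‖y‖² - ‖v‖²), v / ‖v‖)` (range
`{q₂ < 1} × S¹`), that of the open solid torus is `jB (p, v) = (σ p, v)` with `σ` the inverse
stereographic projection from the south pole (range `{q₂ > 0} × S¹`); the two ranges cover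
`S² × S¹`, and `jA a = jB b ↔ surgeryRel ν a b` is `SurgeryUnknot.glueA_eq_glueB_iff`.
[cite: RolfsenKnotsLinks1976, §9.G Example 3] [cite: Kirby1989, Ch. I §2] [cite: GompfStipsiczGSM1999, §5.3] -/
theorem isIntegralSurgery_unknot_zero_holds : isIntegralSurgery_unknot_zero :=
  ⟨unknotTube, hasFraming_unknotTube, glueA, glueB, isSmoothEmbedding_glueA,
    by rw [range_glueA]; exact isOpen_height_lt_one, isSmoothEmbedding_glueB,
    by rw [range_glueB]; exact isOpen_height_pos, range_glueA_union_range_glueB,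
    glueA_eq_glueB_iff⟩

end Literature.Topology.FourManifolds
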